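import Summits.AnomalousDissipation.AnomalousDissipation.Theorems.ScalarAnomalySteadySourceFormal.Negative.KillShape
import Summits.AnomalousDissipation.AnomalousDissipation.Theorems.ScalarAnomalySteadySourceFormal.Negative.ForcedClassicalWeak
import Summits.AnomalousDissipation.AnomalousDissipation.Theorems.ScalarAnomalySteadySourceFormal.Negative.HeatProfile
import Summits.AnomalousDissipation.AnomalousDissipation.Theorems.ScalarAnomalySteadySourceFormal.Negative.ForcedToolkit
import Summits.AnomalousDissipation.AnomalousDissipation.Theorems.ScalarAnomalySteadySourceFormal.Negative.ForcedModes
import Summits.AnomalousDissipation.AnomalousDissipation.Theorems.ScalarAnomalySteadySourceFormal.Negative.RestFlowSteady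
import Summits.AnomalousDissipation.AnomalousDissipation.Theorems.ScalarAnomalySteadySourceFormal.Negative.RestFlowNoGo
import Summits.AnomalousDissipation.AnomalousDissipation.Theorems.ScalarAnomalySteadySourceFormal.Negative.ShearSwept
import Summits.AnomalousDissipation.AnomalousDissipation.Theorems.ScalarAnomalySteadySourceFormal.Negative.ScalarReach
import Summits.AnomalousDissipation.AnomalousDissipation.Theorems.ScalarAnomalySteadySourceFormal.Negative.CellQuant
import Summits.AnomalousDissipation.AnomalousDissipation.Theorems.ScalarAnomalySteadySourceFormal.Negative.WienNoGo
import Literature.Analysis.FluidPDE.LongTimeAveragePeriodic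
import Literature.Analysis.FluidPDE.LongTimeAverageNonneg
import Literature.Analysis.FluidPDE.PassiveScalarFourier
import Literature.Analysis.FluidPDE.PassiveScalarEnergySlice
import Literature.Analysis.FluidPDE.PassiveScalarEnergyPointwise
import Literature.Analysis.FluidPDE.PassiveScalarEnergyProofs
import Literature.Analysis.FluidPDE.PassiveScalarSpectralBounds
import Literature.Analysis.FluidPDE.EulerReynolds
import Literature.Analysis.FunctionSpaces.TorusFourierSynthesis
import Literature.Analysis.FunctionSpaces.TorusInverseLaplacianCalculus
import Literature.Analysis.FunctionSpaces.TorusFourierCalculus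
import Literature.Analysis.FunctionSpaces.TorusFourierConvolution
import Literature.Analysis.FunctionSpaces.TorusSpectralWeakDerivative
import Literature.Analysis.FunctionSpaces.TorusFirstOrderOps
import Literature.Analysis.FunctionSpaces.TorusFourierModes
import Literature.Analysis.FunctionSpaces.TorusTrigPoly
import Literature.Analysis.FunctionSpaces.TorusInverseLaplacian
import Literature.Analysis.FunctionSpaces.TorusSobolevNormFacts

/-!
# Disproof work file — crux `TwoAndHalfD.ScalarAnomalySteadySourceFormal`
(item stmt-AnomalousDissipation-0448, crux slug `scalar_anomaly_steady_source_formal`)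

Standing adversary (cdisprove), generation 1, cycles 1–5 (cycle 4 = §9 shear–drift no-go, cycle 5 = §10
uniformly band-limited no-go, both 2026-08-16; their modules are being landed under `Negative/Shear*`,
`Negative/Cell*` and will be imported here once accepted — until then the kernel certificates are the
item evidence files `ShearDriftNoGo_flat.lean` (2256 lines) and `BandLimitedNoGo_flat.lean` (3177 lines)).  Prose lives only in docstrings; every `theorem`
is checked (`lean check` rc 0, no `sorry` unless marked NEAR-MISS in its docstring).

LANDED certified copies (importable; `Summits/…/Theorems/ScalarAnomalySteadySourceFormal/Negative/`, all ACCEPTED):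
`KillShape` (§1–§2, p73136) · `ForcedClassicalWeak` (§3.1, p74882) · `HeatProfile` (§3.2–§3.3, p75222) ·
`LoadBearing` (§4, p75642, reviewed) · `ForcedToolkit` (§6 toolkit + linearity `forced_sub`, p75174) ·
`ForcedModes` (§7, p75281) · `RestFlowSteady` + `RestFlowNoGo` (§6, p75633, p75746) ·
`DriftState` (§8 steady state, p76771) · `DriftCore` (§8 modal decay + variance floor, p77253) ·
`DriftDissipation` (§8 dissipation ceiling, p77905, reviewed) · `DriftNoGo` (§8 assembly
`constantDrift_not_anomalous` / `not_cruxConstantDrift`, p78380) · §9 shear–drift chain `ShearModes` p83859,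
`ShearRepr` p84217, `ShearBand` p88708, `ShearFlux` p88882, `ShearLimit` p89307, `ShearTotal` p89805,
`ShearHonest` p90171, `ShearNoGo` p90342, `ShearSwept` p92130 · §10 band-limited chain `CellFlux` p91003,
`CellLimit` p91445, `CellTotal` p92138, `CellNoGo` p92179, `CellQuant` (§10.5) p93031 · §11 `ScalarReach`
p91132 · §12 Wiener chain `WienModes` p91164, `WienRepr` p92187, `WienBand` p92719, `WienFlux` p93041,
`WienLimit` p93125, `WienOuter` p93459, `WienNoGo` p93688, `WienSobolev` (§12.8) p94333 — 35 files in all.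
Planner-facing summary table: `Cruxes/ScalarAnomalySteadySourceFormal/WITNESS-CONSTRAINTS.md`.

## Where the checked content lives now
Sections §1–§3 and §6–§7 are IMPORTED from the landed `Negative/` modules (this work file exceeded
the 200 kB crux-write limit when self-contained); §4 and §8 are ALSO landed (`LoadBearing`,
`Drift*`) but kept in full below as the readable record (namespace `…Cruxes.….Disproof`, no clash).
All statements quoted in the index are kernel-checked, standard axioms
(`propext`, `Classical.choice`, `Quot.sound`); this file has NO `sorry`.

## Index of findings (generation 1, cycles 1–6)

* §1 `crux_iff` / `not_crux_iff`: the crux split into named clauses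
  (`IsAdmissible`, `IsCandidate`, `EnergyBounded`, `VarianceBounded`, `Anomalous`) and the exact
  KILL SHAPE: a refutation is a UNIFORM no-anomaly theorem "for every admissible `(g,h)` and
  every candidate family with the two `limsup`-mean bounds, the scalar dissipation means dip
  below every `ε > 0` at some `j`" — nothing less (`IsCandidate.comp_strictMono`: subsequences).
* §2 JUNK CALCULUS of `longTimeAvgSup` (`Real.sInf ∅ = 0`, `Real.sInf` of a set unbounded below
  `= 0`): `longTimeAvgSup_const`, `longTimeAvgSup_eq_zero_of_tendsto_atTop` (divergent Cesàro
  means have long-time average `0`), hence `varianceBounded_of_tendsto_atTop` (clause (v) is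
  VACUOUS on families with divergent variance means) and, dually,
  `isBoundedUnder_timeMean_of_le_longTimeAvgSup` / `isCoboundedUnder_…` /
  `frequently_le_timeMean_…` (the anomaly clause (vi) is junk-proof: it forces honest,
  eventually bounded, frequently `≥ ε-δ` dissipation means).
* §3 A NON-JUNK MODEL of every clause but one.  `isWeakScalarTransportForcedOn_of_classical`
  (general `d`): classical forced scalar solutions are weak forced solutions — the support lemma
  `ClassicalForcedScalarIsWeak` the crux cards (orbit riding, Green–Kubo) declared missing, PROVED.
  One-mode calculus `cosMode` (`laplacian_cosMode`, `hasZeroMean_cosMode`, `∫cos² = 1/2`,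
  `toReal_eScalarGradNormSq_of_eigen`: `‖∇A‖² = λ∫A²` for `ΔA = -λA`, spectral norm of the crux);
  the flow at rest is a global Leray–Hopf solution (`isGlobalLerayHopf_rest`, the crux has NO
  `g ≠ 0` clause); the steady heat profile `θ_∞ = a cos(2πk·x)/(νλ_k)` is a classical, hence weak,
  sourced solution with HONEST constant means `⟨‖θ_∞‖²⟩ = a²/(2ν²λ²)`, `⟨ν‖∇θ_∞‖²⟩ = a²/(2νλ)`.
* §4 LOAD-BEARING ANALYSIS (all kernel-checked, standard axioms):
  - `cruxWithoutVarianceBound_holds`: delete clause (v) ⇒ the crux is TRUE (heat, `ν_j = 1/(j+1)`,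
    dissipation `(j+1)/(8π²)`); `varianceUnbounded_heatFamily`: that family breaks (v) honestly.
  - `cruxIndexedSource_holds`: let the source depend on `j` (`h_j = cos(2π(j+1)x₁)`,
    `ν_j = (j+1)⁻²`) ⇒ TRUE with bounded variance `1/(32π⁴)` and anomaly `1/(8π²)`: the scalar
    twin of `Cheskidov2023_thm13_not_forceRobustNoAnomaly` — any refutation must use that `h` is
    ONE fixed function; no scale-blind / force-robust estimate can kill the crux.
  - `cruxWithoutFloor_holds`: the solution clauses + BOTH `limsup` bounds have an honest model
    (non-vacuity of the hypothesis bundle; (vi) is what a proof must earn).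
  - `heatFamily_not_anomalous`: the steady-heat sub-family is DEAD
    (`⟨ν‖∇θ‖²⟩ = νλ⟨‖θ‖²⟩ ≤ νλE → 0`, `dissipation_eq_mul_variance_heat`).
* §5 VERDICT / why it resists / dead sub-families on paper / next targets (docblock at the end).
* §6 REFUTED STRENGTHENING, the flow at rest (cycle 2, kernel-checked): `not_cruxRestFlow` — NO
  witness of the crux has `v_j ≡ 0`, for ANY `L²` data and ANY weak solutions of the crux's class;
  `source_eq_zero`: at rest, the variance clause alone forces `h = 0`.  Built from a forced-class
  toolkit (`forced_sub`: linearity; product-form weak identity), the a.e. Volterra lemma, the steady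
  state `-(1/ν)Δ⁻¹h` and its Fourier coefficients, exact modal decay of the fluctuation, an HONEST
  variance floor `‖𝓕θ_p(k)‖²/8 ≤ ⟨‖θ‖²⟩`, and the tree's energy inequality.  Certifies that the typed
  weak class has no junk door at rest.
* §7 INFRASTRUCTURE (cycle 2, kernel-checked): `forced_ae_mFourierCoeff_eq` — the modewise integral
  identity for EVERY witness scalar (forced class, any velocity, steady integrable source), and
  `forced_ae_mFourierCoeff_zero_eq` — mean conservation.  Entry point of all modal attacks; the
  other half of the provers' glue `SourcedScalarWellPosed2D`.
* §8 REFUTED STRENGTHENING, constant drifts / Galilean states (cycle 3, kernel-checked):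
  `not_cruxConstantDrift` — NO witness has `v_j ≡ c_j` constant, for ANY `L²` data and ANY weak
  solutions (drift steady state by Fourier synthesis, exact complex modal decay, honest multi-mode
  variance floors, a dissipation CEILING `⟨ν‖∇θ‖²⟩ ≤ 8π²ν∑|k|²‖q_k‖²`, K-split + spectral tail of `h`).
* §9 REFUTED STRENGTHENING, SHEAR–DRIFT STIRRING (cycle 4, kernel-checked, std axioms; folder
  files `neg/Shear{Modes,Repr,Band,Flux,Limit,Total,Honest,NoGo,Swept}.lean`, flat certificate
  `ShearDriftNoGo_flat.lean` = item evidence, 2256 lines rc0; landing as `Negative/Shear*`):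
  `shearDrift_not_anomalous` — velocity fields `u_j(t) = realTrigPoly S (c_j t)` on ONE finite axis
  set `S ⊆ {k : k 1 = 0, |k 0| ≤ R}` (band-limited parallel shear `(m₀(t), m₁(t) + W_j(t,x₀))` plus
  arbitrary uniform drift), coefficient paths continuous, bounded by `M` uniformly in `j`,
  transversal; ONE smooth mean-zero `h`; `ν_j → 0`; ANY `L²` data; ANY weak solutions of the class:
  `VarianceBounded ⇒ ¬Anomalous`.  `sweptMarchioro_not_anomalous`: the Galilean-swept Marchioro
  family `marchioroSweptState α ν_j m` (`m 0 ≠ 0`; the bounded-energy NS family that settles crux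
  #3 `TwodBoundedEnergy` TRUE for the wrong reason, cf. the 2026-08-16 route repair #3′
  `TwodBoundedEnergyZeroMomentum`) carries NO scalar anomaly — in Lean, for all data/solutions.
  Also: `perT_dissipation_le` (every such weak solution has FINITE dissipation integral on every
  `(0,T)`, with an explicit bound), `honest_variance` (Poincaré + mean conservation close the
  (v)-junk door whenever the dissipation integral is finite), `weak_congr_velocity`.
* §10 REFUTED STRENGTHENING, ANY UNIFORMLY BAND-LIMITED STIRRING (cycle 5, kernel-checked, std
  axioms; folder files `neg/Cell{Flux,Limit,Total,NoGo}.lean` on top of the §9 chain, flat certificate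
  `BandLimitedNoGo_flat.lean` = item evidence, 3177 lines rc0; landing as `Negative/Cell*` after
  `Negative/Shear*`): `bandLimited_not_anomalous` / `not_cruxBandLimited` — `u_j(t) = realTrigPoly S (c_j t)`
  on ONE finite set `S ⊆ {|k 0| ≤ R, |k 1| ≤ R}` of ANY geometry (cellular flows, swept cellular
  states, every FIXED Galerkin truncation of planar NS with bounded coefficients), coefficients
  continuous, bounded uniformly in `j`, transversal; one smooth mean-zero `h`; `ν_j → 0`; any `L²`
  data; any weak solutions: `VarianceBounded ⇒ ¬Anomalous`.  HENCE: a witness of the crux needs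
  stirring with `j`-UNBOUNDED SPECTRAL REACH — the Batchelor (smooth-stirring) regime is dead in Lean.
* §10.5 QUANTITATIVE BATCHELOR NO-GO (cycle 5, kernel-checked, std axioms; LANDED CellQuant p93031; folder `neg/CellQuant.lean`,
  evidence `CellQuant_chain.lean`; full flat certificate 3500 lines rc0): `growingBand_not_anomalous` —
  `j`-dependent bands `S_j ⊆ {|k|_∞ ≤ R_j}`, coefficients `≤ M_j`: if `R_j·#S_j·M_j = o(log(1/ν_j))` and
  `log(R_j+1) ≤ γ log(1/ν_j)` eventually (`γ < 1/2`), then `VarianceBounded ⇒ ¬Anomalous`.  Contrapositive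
  = NECESSARY CONDITION ON WITNESSES: along a subsequence the Wiener-type stirring strength
  `R_j #S_j M_j ≳ log(1/ν_j)` (Batchelor threshold for `‖∇v_j‖_∞`-scale quantities) or the Fourier
  support of `v_j` reaches `ν_j^{-1/2+o(1)}`.  Tools: `cell_member_no_floor` (numerical heart, one
  member), `log_window_le_harmonic` (`log((c+n)/c) ≤ ∑_{x<n}(c+x)⁻¹`), `quant_viscous_budget`.
* §11 SCALAR SPECTRAL REACH (cycle 5, kernel-checked; LANDED ScalarReach p91132; folder `neg/ScalarReach.lean`, evidence
  `ScalarReach_chain.lean`): `scalarBandLimited_not_anomalous` — for ANY velocities, data and weak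
  solutions of the class, scalars band-limited to `|k| ≤ Λ_j` with `ν_jΛ_j² → 0` and bounded variance
  are not anomalous (Bernstein `‖∇θ‖² ≤ 4π²Λ²‖θ‖²` + honest variance).  So a witness' scalar carries,
  in time-mean and uniformly in `j`, spectral mass at the diffusive scale `|k| ≳ (ε/E)^{1/2}(2π)⁻¹ν_j^{-1/2}`;
  combined with §10.5 (velocity side): anomaly needs BOTH a `log(1/ν)`-strong stirring and a scalar
  cascade reaching `ν^{-1/2}`.
* §12 REFUTED STRENGTHENING, UNIFORMLY WIENER-CLASS STIRRING (cycle 6, kernel-checked, std axioms; LANDED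
  WienModes p91164, WienRepr p92187, WienBand p92719, WienFlux p93041, WienLimit p93125, WienOuter p93459, WienNoGo p93688;
  folder `neg/Wien{Modes,Repr,Band,Flux,Limit,Outer,NoGo}.lean`, evidence `Wiener_chain.lean`; flat
  certificate 3644 lines rc0): `wiener_not_anomalous` — velocities `u_j(s) = wienField (C_j s)` with
  INFINITE Fourier support: arbitrary continuous coefficient paths `C_j s : ℤ² → ℂ²`, conjugate
  symmetric, transversal, dominated UNIFORMLY IN `j` by one majorant `a` with `∑ a_q`, `∑ r_q a_q`,
  `∑ r_q² a_q < ∞` (`r_q = |q|_∞`; contains every family bounded in `C_t H^{3+δ}_x` uniformly in `j`):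
  `ν_j → 0`, one smooth mean-zero `h`, ANY `L²` data and weak solutions ⇒ (`VarianceBounded ⇒
  ¬Anomalous`); corollary `not_anomalous_of_isCandidate_wiener`.  HENCE A CRUX WITNESS IS UNBOUNDED IN
  EVERY SUCH NORM — its stirring must roughen without bound as `ν_j → 0` (a theorem-level shadow of
  the Batchelor picture; cf. §10.5 for the quantitative band-limited rate).  New tools:
  `mFourierCoeff_mul_wienField` (product ↦ convolution series, `integral_tsum`), transport-series
  continuity by the M-test, `le_of_ae_le_of_continuousOn`, finite-interior/series-boundary split
  with the involution `(p,r) ↦ (r,p)`, shift-by-shift flux bound (reusing `cell_sum_boundary_le`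
  with `R = r_q`), Tannery's theorem for the outer truncation, harmonic pigeonhole with
  shift-dependent layer widths (`exists_wInner_small`).
* §12.8 FOURIER-DECAY FORM (kernel-checked; LANDED WienSobolev p94333; folder `neg/WienSobolev.lean`, evidence `Wiener_chain.lean`):
  `fourierDecay_not_anomalous` — velocities continuous in `x` and `t`, spectrally divergence-free, with
  UNIFORM decay `‖𝓕v_j(t)(q)‖ ≤ B (1+|q|_∞)^{-σ}`, `σ > 4` (e.g. bounded in `C_t C⁶_x` uniformly in
  `j`) cannot witness the crux; `not_anomalous_of_isCandidate_fourierDecay`.  (Lattice summability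
  `∑_{ℤ²}(1+|q|_∞)^{-τ} < ∞`, `τ > 2`, via `ℤ × ℤ`; synthesis `v = wienField (vecCoeff v)`.)
-/

set_option linter.dupNamespace false

noncomputable section

open scoped BigOperators Topology ENNReal NNReal InnerProductSpace ContDiff
open Filter Set Function MeasureTheory UnitAddTorus Complex

namespace Summit.AnomalousDissipation.AnomalousDissipation.Cruxes.ScalarAnomalySteadySourceFormal.Disproof

open Literature.Analysis
open Literature.Analysis.FunctionSpaces Literature.Analysis.FunctionSpaces.Torus
open Literature.Analysis.FluidPDE Literature.Analysis.FluidPDE.Torus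
open Summit.AnomalousDissipation.AnomalousDissipation.Theses.TwoAndHalfD
open Summit.AnomalousDissipation.AnomalousDissipation.Theorems.ScalarAnomalySteadySourceFormal.Negative

/-- The flat two-torus `T²`. -/
local notation "𝕋²" => UnitAddTorus (Fin 2)
/-- Planar velocity values. -/
local notation "E²" => EuclideanSpace ℝ (Fin 2)

/-! ## §1–§3, §6–§7: see the imported `Negative.*` modules (index above). -/

/-! ## §4 Load-bearing analysis: which clauses carry the difficulty

For an `∃`-crux, deleting a clause makes the statement WEAKER; the informative facts are which
deletions make it PROVABLE (those clauses are load-bearing for any refutation) and which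
strengthenings are refutable.  The heat profile of §3 settles three deletions.
-/

section LoadBearing

/-- The viscosity ladder `ν_j = 1/(j+1)`. [folklore] -/
def nuSeq (j : ℕ) : ℝ := 1 / ((j : ℝ) + 1)

theorem nuSeq_pos (j : ℕ) : 0 < nuSeq j := by
  unfold nuSeq; positivity

theorem nuSeq_le_one (j : ℕ) : nuSeq j ≤ 1 := by
  unfold nuSeq
  rw [div_le_one (by positivity)]
  linarith [(Nat.cast_nonneg j : (0 : ℝ) ≤ j)]

theorem tendsto_nuSeq : Tendsto nuSeq atTop (nhds 0) :=
  tendsto_one_div_add_atTop_nhds_zero_nat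

/-- The first axial frequency `e₀ = (1, 0)`. [folklore] -/
abbrev k₁ : Fin 2 → ℤ := axialFreq 1

theorem k₁_ne_zero : k₁ ≠ 0 := axialFreq_ne_zero one_ne_zero

theorem lam_k₁ : lam k₁ = 4 * Real.pi ^ 2 := by
  rw [lam_axialFreq]; push_cast; ring

theorem lam_k₁_pos : 0 < lam k₁ := lam_pos_axialFreq one_ne_zero

/-- **The crux WITHOUT the variance clause (v).** [folklore] -/
def CruxWithoutVarianceBound : Prop :=
  ∃ (g : 𝕋² → E²) (h : 𝕋² → ℝ), IsAdmissible g h ∧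
    ∃ (ν : ℕ → ℝ) (v₀ : ℕ → 𝕋² → E²) (v : ℕ → ℝ → 𝕋² → E²) (θ₀ : ℕ → 𝕋² → ℝ)
      (θ : ℕ → ℝ → 𝕋² → ℝ), IsCandidate g h ν v₀ v θ₀ θ ∧ EnergyBounded v ∧ Anomalous ν θ

/-- **LOAD-BEARING (v): without the variance bound the crux is TRUE, by the heat equation.**
Witness: `g = 0`, flow at rest, `h = cos(2πx₁)`, `ν_j = 1/(j+1)`, `θ_j ≡ θ₀_j = h/(4π²ν_j)`:
honest mean dissipation `(j+1)/(8π²) ≥ 1/(8π²)`.  Hence ANY refutation of the crux must use the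
scalar-variance bound quantitatively — dissipation of order `1/ν` is available without it — and
the bound is violated by this family exactly at the rate `⟨‖θ_j‖²⟩ = (j+1)²/(32π⁴)`
(`varianceUnbounded_heatFamily`). [folklore] -/
theorem cruxWithoutVarianceBound_holds : CruxWithoutVarianceBound := by
  refine ⟨fun _ => 0, cosMode k₁ 1, isAdmissible_zero_cosMode k₁_ne_zero 1, nuSeq, fun _ _ => 0,
    fun _ _ _ => 0, fun j => heatProfile k₁ 1 (nuSeq j), fun j _ => heatProfile k₁ 1 (nuSeq j),
    ⟨nuSeq_pos, tendsto_nuSeq, fun j => isGlobalLerayHopf_rest (nuSeq j),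
      fun j => memLp_heatProfile k₁ 1 (nuSeq j),
      fun j => heatProfile_isWeak lam_k₁_pos.ne' (nuSeq_pos j).ne' 1⟩,
    ⟨0, fun j => meanEnergy_rest.le⟩,
    ⟨1 / (2 * lam k₁), by have := lam_k₁_pos; positivity, fun j => ?_⟩⟩
  rw [longTimeAvgSup_dissipation_heatProfile k₁_ne_zero lam_k₁_pos.ne' (nuSeq_pos j).ne', one_pow]
  apply one_div_le_one_div_of_le
  · exact mul_pos two_pos (mul_pos (nuSeq_pos j) lam_k₁_pos)
  · have h1 := nuSeq_le_one j
    have h2 := lam_k₁_pos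
    nlinarith

/-- The same heat family violates clause (v) honestly: its mean variances
`⟨‖θ_j‖²⟩ = ((j+1)/(4π²))²/2` are unbounded in `j` (so it is NOT a witness of the crux — the
variance clause alone rules it out). [folklore] -/
theorem varianceUnbounded_heatFamily :
    ¬ VarianceBounded (fun j (_ : ℝ) => heatProfile k₁ 1 (nuSeq j)) := by
  rintro ⟨E, hE⟩
  have hval : ∀ j : ℕ, longTimeAvgSup (fun _ : ℝ => scalarL2Sq (heatProfile k₁ 1 (nuSeq j))) =
      (((j : ℝ) + 1) / lam k₁) ^ 2 / 2 := fun j => by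
    rw [longTimeAvgSup_scalarL2Sq_heatProfile k₁_ne_zero, nuSeq]
    congr 2
    field_simp
  -- pick `j` with `((j+1)/λ)²/2 > E`
  obtain ⟨j, hj⟩ := exists_nat_gt (2 * |E| * lam k₁ ^ 2 + lam k₁ ^ 2)
  have h := hE j
  rw [hval j] at h
  have hl := lam_k₁_pos
  have hj1 : (1 : ℝ) ≤ (j : ℝ) + 1 := by linarith [(Nat.cast_nonneg j : (0 : ℝ) ≤ j)]
  have hE' : E ≤ |E| := le_abs_self E
  have hval' : (((j : ℝ) + 1) / lam k₁) ^ 2 / 2 = ((j : ℝ) + 1) ^ 2 / (2 * lam k₁ ^ 2) := by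
    field_simp
  have hsq : (j : ℝ) + 1 ≤ ((j : ℝ) + 1) ^ 2 := by nlinarith
  have step1 : ((j : ℝ) + 1) / (2 * lam k₁ ^ 2) ≤ ((j : ℝ) + 1) ^ 2 / (2 * lam k₁ ^ 2) :=
    div_le_div_of_nonneg_right hsq (by positivity)
  have step2 : (2 * |E| * lam k₁ ^ 2 + lam k₁ ^ 2) / (2 * lam k₁ ^ 2) < ((j : ℝ) + 1) / (2 * lam k₁ ^ 2) :=
    div_lt_div_of_pos_right (by linarith) (by positivity)
  have step3 : (2 * |E| * lam k₁ ^ 2 + lam k₁ ^ 2) / (2 * lam k₁ ^ 2) = |E| + 1 / 2 := by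
    field_simp
  rw [hval'] at h
  linarith

/-- **The crux WITH AN INDEXED SOURCE** (`h_j` may depend on `j`, each smooth and mean zero; all
other clauses verbatim). [folklore] -/
def CruxIndexedSource : Prop :=
  ∃ (g : 𝕋² → E²) (h : ℕ → 𝕋² → ℝ), (∀ j, IsAdmissible g (h j)) ∧
    ∃ (ν : ℕ → ℝ) (v₀ : ℕ → 𝕋² → E²) (v : ℕ → ℝ → 𝕋² → E²) (θ₀ : ℕ → 𝕋² → ℝ)
      (θ : ℕ → ℝ → 𝕋² → ℝ), (∀ j, 0 < ν j) ∧ Tendsto ν atTop (nhds 0) ∧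
        (∀ j, IsGlobalLerayHopf (ν j) (fun _ => g) (v₀ j) (v j)) ∧ (∀ j, MemLp (θ₀ j) 2 volume) ∧
        (∀ j, IsWeakScalarTransportForced (ν j) (v j) (fun _ => h j) (θ₀ j) (θ j)) ∧
        EnergyBounded v ∧ VarianceBounded θ ∧ Anomalous ν θ

/-- The frequency ladder `k_j = (j+1, 0)` with `λ_{k_j} = 4π²(j+1)²`. [folklore] -/
def kSeq (j : ℕ) : Fin 2 → ℤ := axialFreq ((j : ℤ) + 1)

theorem kSeq_ne_zero (j : ℕ) : kSeq j ≠ 0 :=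
  axialFreq_ne_zero (by exact_mod_cast Nat.succ_ne_zero j)

theorem lam_kSeq (j : ℕ) : lam (kSeq j) = 4 * Real.pi ^ 2 * ((j : ℝ) + 1) ^ 2 := by
  rw [kSeq, lam_axialFreq]; push_cast; ring

theorem lam_kSeq_pos (j : ℕ) : 0 < lam (kSeq j) := by rw [lam_kSeq]; positivity

/-- The viscosity ladder `ν_j = 1/(j+1)²`, tuned so that `ν_j λ_{k_j} = 4π²`. [folklore] -/
def nuSeq₂ (j : ℕ) : ℝ := (1 / ((j : ℝ) + 1)) ^ 2

theorem nuSeq₂_pos (j : ℕ) : 0 < nuSeq₂ j := by unfold nuSeq₂; positivity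

theorem tendsto_nuSeq₂ : Tendsto nuSeq₂ atTop (nhds 0) := by
  have h := (tendsto_one_div_add_atTop_nhds_zero_nat (𝕜 := ℝ)).pow 2
  rw [zero_pow two_ne_zero] at h
  exact h

theorem nuSeq₂_mul_lam (j : ℕ) : nuSeq₂ j * lam (kSeq j) = 4 * Real.pi ^ 2 := by
  rw [nuSeq₂, lam_kSeq]
  field_simp

/-- **LOAD-BEARING (ν-independence of the source): with a `j`-dependent source the crux is TRUE,
by the heat equation at the diffusive scale.**  Witness: flow at rest,
`h_j = cos(2π(j+1)x₁)`, `ν_j = (j+1)⁻²` (so `ν_j λ_{k_j} = 4π²`), `θ_j ≡ h_j/(4π²)`: honest means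
`⟨‖θ_j‖²⟩ = 1/(32π⁴)` (bounded) and `⟨ν_j‖∇θ_j‖²⟩ = 1/(8π²)` (anomalous).  Hence ANY refutation
must use that `h` is ONE fixed function (its spectrum cannot follow the diffusive scale
`|k| ~ ν^{-1/2}`) — the scalar twin of the catalogued
`Cheskidov2023_thm13_not_forceRobustNoAnomaly` (ν-dependent forces DO produce anomalies), and the
reason no "force-robust" energy estimate can kill the crux. [folklore] -/
theorem cruxIndexedSource_holds : CruxIndexedSource := by
  refine ⟨fun _ => 0, fun j => cosMode (kSeq j) 1, fun j => isAdmissible_zero_cosMode (kSeq_ne_zero j) 1,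
    nuSeq₂, fun _ _ => 0, fun _ _ _ => 0, fun j => heatProfile (kSeq j) 1 (nuSeq₂ j),
    fun j _ => heatProfile (kSeq j) 1 (nuSeq₂ j), nuSeq₂_pos, tendsto_nuSeq₂,
    fun j => isGlobalLerayHopf_rest (nuSeq₂ j), fun j => memLp_heatProfile _ 1 _,
    fun j => heatProfile_isWeak (lam_kSeq_pos j).ne' (nuSeq₂_pos j).ne' 1,
    ⟨0, fun j => meanEnergy_rest.le⟩, ⟨(1 / (4 * Real.pi ^ 2)) ^ 2 / 2, fun j => ?_⟩,
    ⟨1 / (2 * (4 * Real.pi ^ 2)), by positivity, fun j => ?_⟩⟩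
  · rw [longTimeAvgSup_scalarL2Sq_heatProfile (kSeq_ne_zero j), nuSeq₂_mul_lam]
  · rw [longTimeAvgSup_dissipation_heatProfile (kSeq_ne_zero j) (lam_kSeq_pos j).ne' (nuSeq₂_pos j).ne',
      nuSeq₂_mul_lam, one_pow]

/-- **The crux WITHOUT the anomaly floor (vi)** (all solution clauses and both `limsup` bounds). [folklore] -/
def CruxWithoutFloor : Prop :=
  ∃ (g : 𝕋² → E²) (h : 𝕋² → ℝ), IsAdmissible g h ∧
    ∃ (ν : ℕ → ℝ) (v₀ : ℕ → 𝕋² → E²) (v : ℕ → ℝ → 𝕋² → E²) (θ₀ : ℕ → 𝕋² → ℝ)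
      (θ : ℕ → ℝ → 𝕋² → ℝ), IsCandidate g h ν v₀ v θ₀ θ ∧ EnergyBounded v ∧ VarianceBounded θ

/-- **NON-VACUITY of the hypothesis bundle**: the solution clauses together with BOTH `limsup`
bounds have an honest (non-junk) model — flow at rest, zero source, zero scalar (written as the
amplitude-`0` heat profile so that §3 applies verbatim).  Only the floor `ε > 0` separates this
model from a witness: clause (vi) is load-bearing for any proof, as (v) is for any refutation. [folklore] -/
theorem cruxWithoutFloor_holds : CruxWithoutFloor := by
  refine ⟨fun _ => 0, cosMode k₁ 0, isAdmissible_zero_cosMode k₁_ne_zero 0, nuSeq, fun _ _ => 0,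
    fun _ _ _ => 0, fun j => heatProfile k₁ 0 (nuSeq j), fun j _ => heatProfile k₁ 0 (nuSeq j),
    ⟨nuSeq_pos, tendsto_nuSeq, fun j => isGlobalLerayHopf_rest (nuSeq j),
      fun j => memLp_heatProfile k₁ 0 (nuSeq j),
      fun j => heatProfile_isWeak lam_k₁_pos.ne' (nuSeq_pos j).ne' 0⟩,
    ⟨0, fun j => meanEnergy_rest.le⟩, ⟨0, fun j => ?_⟩⟩
  rw [longTimeAvgSup_scalarL2Sq_heatProfile k₁_ne_zero]
  simp

/-- For the record, the zero-amplitude family has identically vanishing dissipation means: the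
three clauses (iv), (v), (vi) cannot be met by the heat equation with a FIXED source at ANY
amplitude — large amplitude/ small `ν` breaks (v) (`varianceUnbounded_heatFamily`), and the
dissipation mean `a²/(2νλ)` is monotone in the same parameter `a²/ν` as the variance
`a²/(2ν²λ²)·…`: along any heat family, `⟨ν‖∇θ‖²⟩ = νλ · ⟨‖θ‖²⟩·… ≤ λ ν_j · E → 0`
(`dissipation_le_of_variance_heat`). [folklore] -/
theorem dissipation_eq_mul_variance_heat {k : Fin 2 → ℤ} (hk : k ≠ 0) (hlam : lam k ≠ 0) {ν : ℝ}
    (hν : ν ≠ 0) (a : ℝ) :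
    longTimeAvgSup (dissipation ν (fun _ => heatProfile k a ν)) =
      ν * lam k * longTimeAvgSup (fun _ : ℝ => scalarL2Sq (heatProfile k a ν)) := by
  rw [longTimeAvgSup_dissipation_heatProfile hk hlam hν, longTimeAvgSup_scalarL2Sq_heatProfile hk]
  field_simp

/-- **The steady heat sub-family is dead**: if a family of steady heat profiles (fixed mode `k`,
amplitudes `a_j`, viscosities `ν_j → 0`) has mean variance `≤ E`, its mean dissipation is
`≤ λ_k ν_j E → 0`; in particular it dips below every `ε > 0`. [folklore] -/
theorem heatFamily_not_anomalous {k : Fin 2 → ℤ} (hk : k ≠ 0) (hlam : 0 < lam k) {ν : ℕ → ℝ}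
    (hν : ∀ j, 0 < ν j) (hν0 : Tendsto ν atTop (nhds 0)) (a : ℕ → ℝ) {E : ℝ}
    (hE : ∀ j, longTimeAvgSup (fun _ : ℝ => scalarL2Sq (heatProfile k (a j) (ν j))) ≤ E) :
    ¬ Anomalous ν (fun j _ => heatProfile k (a j) (ν j)) := by
  rintro ⟨ε, hε, hfloor⟩
  have hE0 : 0 ≤ E := (hE 0).trans' (by
    rw [longTimeAvgSup_scalarL2Sq_heatProfile hk]; positivity)
  -- eventually `ν_j λ E < ε`
  have hev : ∀ᶠ j in atTop, ν j < ε / (lam k * (E + 1)) :=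
    (tendsto_order.1 hν0).2 _ (by positivity)
  obtain ⟨j, hj⟩ := hev.exists
  have h1 := hfloor j
  rw [dissipation_eq_mul_variance_heat hk hlam.ne' (hν j).ne'] at h1
  have h2 : ν j * lam k * longTimeAvgSup (fun _ : ℝ => scalarL2Sq (heatProfile k (a j) (ν j))) ≤
      ν j * lam k * E := mul_le_mul_of_nonneg_left (hE j) (mul_nonneg (hν j).le hlam.le)
  have h3 : ν j * lam k * E < ε := by
    have := hj
    rw [lt_div_iff₀ (by positivity)] at this
    nlinarith [(hν j).le, hlam.le]
  linarith

end LoadBearing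

/-! ## §8 REFUTED STRENGTHENING: constant drifts (Galilean states) are dead — any data, any weak solution

Cycle-3 target (2) of §5, DONE.  For witnesses whose planar flow is a CONSTANT drift `v_j ≡ c_j`
(the Galilean family that settled the original velocity crux 0209 "true for the wrong reason"),
the scalar clause is the drift equation `∂ₜθ + c_j·∇θ = ν_jΔθ + h`.  We construct its steady state
`θ_p = Re ∑ₖ e_k 𝓕h(k)/(4π²ν|k|² + 2πi k·c)` by Fourier synthesis (`driftState`, smooth, solves the PDE,
classical ⇒ weak, coefficients `q_k`), reduce to the homogeneous equation by LINEARITY, get EXACT modal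
decay at the complex rate `a_k` (`dtilde_mode_eq`, §7 modes + Volterra), HONEST multi-mode variance
floors (`d_variance_floor`: `∑_{k∈F}‖q_k‖²/8 ≤ ⟨‖θ‖²⟩`, so `∑ₖ≠0‖q_k‖² ≤ 8E`), a DISSIPATION CEILING
(`d_dissipation_limsup_le`: `⟨ν‖∇θ‖²⟩ ≤ 8π²ν ∑ₖ|k|²‖q_k‖²`, transients average out: `∫₀^∞ 8π²ν|k|²e^{-8π²ν|k|²t}dt = 1`,
Parseval), and the K-SPLIT `∑|k|²‖q_k‖² ≤ Λ·8E + tail_h(Λ)/((4π²ν)²Λ)` at `Λ = μ/ν_j`: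
`⟨ν_j‖∇θ_j‖²⟩ ≤ 64π²μE + tail_h(μ/ν_j)/(2π²μ) → 0`.  Net: `constantDrift_not_anomalous`,
`not_cruxConstantDrift` — detuning (`k·c ≠ 0`) keeps the variance bounded but then the dissipation
is `O(ν)`; resonance blows the variance up; no mixture of the two survives.
-/

section ConstantDriftNoGo

variable {d : Type*} [Fintype d] [DecidableEq d]

/-! ### The drift symbol and the steady state of `c·∇θ = νΔθ + h` -/

/-- The symbol `a_k = 4π²ν|k|² + 2πi (k·c)` of the drift operator `θ ↦ c·∇θ - νΔθ`. [folklore] -/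
def driftSymbol (ν : ℝ) (c : EuclideanSpace ℝ d) (k : d → ℤ) : ℂ :=
  ((4 * Real.pi ^ 2 * ν * freqNormSq k : ℝ) : ℂ) + 2 * Real.pi * I * ((∑ i, (k i : ℝ) * c i : ℝ) : ℂ)

omit [DecidableEq d] in
theorem re_driftSymbol (ν : ℝ) (c : EuclideanSpace ℝ d) (k : d → ℤ) :
    (driftSymbol ν c k).re = 4 * Real.pi ^ 2 * ν * freqNormSq k := by
  rw [driftSymbol, Complex.add_re, Complex.ofReal_re]
  simp [Complex.mul_re, Complex.mul_im]

omit [DecidableEq d] in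
theorem le_norm_driftSymbol (ν : ℝ) (c : EuclideanSpace ℝ d) (k : d → ℤ) :
    4 * Real.pi ^ 2 * ν * freqNormSq k ≤ ‖driftSymbol ν c k‖ := by
  rw [← re_driftSymbol ν c k]
  exact Complex.re_le_norm _

omit [DecidableEq d] in
theorem driftSymbol_ne_zero {ν : ℝ} (hν : 0 < ν) (c : EuclideanSpace ℝ d) {k : d → ℤ} (hk : k ≠ 0) :
    driftSymbol ν c k ≠ 0 := fun h0 => by
  have h1 := le_norm_driftSymbol ν c k
  rw [h0, norm_zero] at h1
  have h2 := lt_of_lt_of_le one_pos (one_le_freqNormSq_of_ne_zero hk)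
  have : 0 < 4 * Real.pi ^ 2 * ν * freqNormSq k := by positivity
  linarith

/-- The Fourier coefficients `q_k = 𝓕h(k)/a_k` (`k ≠ 0`), `q_0 = 0`, of the steady drift state. [folklore] -/
def driftCoeff (ν : ℝ) (c : EuclideanSpace ℝ d) (h : UnitAddTorus d → ℝ) (k : d → ℤ) : ℂ :=
  if k = 0 then 0 else mFourierCoeff (fun x => (h x : ℂ)) k / driftSymbol ν c k

omit [DecidableEq d] in
theorem norm_driftCoeff_le {ν : ℝ} (hν : 0 < ν) (c : EuclideanSpace ℝ d) (h : UnitAddTorus d → ℝ)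
    {k : d → ℤ} (hk : k ≠ 0) :
    ‖driftCoeff ν c h k‖ ≤ ‖mFourierCoeff (fun x => (h x : ℂ)) k‖ / (4 * Real.pi ^ 2 * ν * freqNormSq k) := by
  rw [driftCoeff, if_neg hk, norm_div]
  have h2 := lt_of_lt_of_le one_pos (one_le_freqNormSq_of_ne_zero hk)
  exact div_le_div_of_nonneg_left (norm_nonneg _) (by positivity) (le_norm_driftSymbol ν c k)

omit [DecidableEq d] in
theorem norm_driftCoeff_le' {ν : ℝ} (hν : 0 < ν) (c : EuclideanSpace ℝ d) (h : UnitAddTorus d → ℝ)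
    (k : d → ℤ) :
    ‖driftCoeff ν c h k‖ ≤ (4 * Real.pi ^ 2 * ν)⁻¹ * ‖mFourierCoeff (fun x => (h x : ℂ)) k‖ := by
  by_cases hk : k = 0
  · rw [driftCoeff, if_pos hk, norm_zero]; positivity
  · refine (norm_driftCoeff_le hν c h hk).trans ?_
    have h2 := one_le_freqNormSq_of_ne_zero hk
    rw [div_eq_inv_mul]
    refine mul_le_mul_of_nonneg_right ?_ (norm_nonneg _)
    rw [inv_le_inv₀ (by positivity) (by positivity)]
    nlinarith [Real.pi_pos, mul_pos (mul_pos (by norm_num : (0:ℝ) < 4) (pow_pos Real.pi_pos 2)) hν]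

theorem rapidDecay_driftCoeff {ν : ℝ} (hν : 0 < ν) (c : EuclideanSpace ℝ d) {h : UnitAddTorus d → ℝ}
    (hh : IsSmooth h) : RapidDecay (driftCoeff ν c h) :=
  (hh.ofReal.rapidDecay_mFourierCoeff).of_norm_le_mul fun k => norm_driftCoeff_le' hν c h k

/-- The complex steady drift state `F = ∑_k e_k q_k`. [folklore] -/
def driftStateC (ν : ℝ) (c : EuclideanSpace ℝ d) (h : UnitAddTorus d → ℝ) : UnitAddTorus d → ℂ :=
  fourierSynth (driftCoeff ν c h)

/-- **The steady drift state** `θ_p = Re ∑_k e_k 𝓕h(k)/(4π²ν|k|² + 2πi k·c)`: the smooth solution of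
`c·∇θ_p = νΔθ_p + h` for a smooth mean-zero source. [folklore] -/
def driftState (ν : ℝ) (c : EuclideanSpace ℝ d) (h : UnitAddTorus d → ℝ) : UnitAddTorus d → ℝ :=
  fun x => (driftStateC ν c h x).re

theorem isSmooth_driftStateC {ν : ℝ} (hν : 0 < ν) (c : EuclideanSpace ℝ d) {h : UnitAddTorus d → ℝ}
    (hh : IsSmooth h) : IsSmooth (driftStateC ν c h) :=
  (rapidDecay_driftCoeff hν c hh).isSmooth_fourierSynth

theorem isSmooth_driftState {ν : ℝ} (hν : 0 < ν) (c : EuclideanSpace ℝ d) {h : UnitAddTorus d → ℝ}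
    (hh : IsSmooth h) : IsSmooth (driftState ν c h) :=
  (isSmooth_driftStateC hν c hh).comp_clm Complex.reCLM

theorem mFourierCoeff_driftStateC {ν : ℝ} (hν : 0 < ν) (c : EuclideanSpace ℝ d) {h : UnitAddTorus d → ℝ}
    (hh : IsSmooth h) (k : d → ℤ) : mFourierCoeff (driftStateC ν c h) k = driftCoeff ν c h k :=
  (rapidDecay_driftCoeff hν c hh).mFourierCoeff_fourierSynth k

/-- **Symbol calculus**: for smooth `Φ : T^d → ℂ`,
`𝓕(∑ⱼ cⱼ ∂ⱼΦ - νΔΦ)(k) = a_k 𝓕Φ(k)`. [folklore] -/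
theorem mFourierCoeff_driftOp {ν : ℝ} (c : EuclideanSpace ℝ d) {Φ : UnitAddTorus d → ℂ} (hΦ : IsSmooth Φ)
    (k : d → ℤ) :
    mFourierCoeff (fun x => ∑ j, (c j : ℂ) * partialDeriv j Φ x - (ν : ℂ) * laplacian Φ x) k =
      driftSymbol ν c k * mFourierCoeff Φ k := by
  have hint : ∀ j, Integrable (fun x => (c j : ℂ) * partialDeriv j Φ x) volume :=
    fun j => (hΦ.partialDeriv j).integrable.const_mul _
  have e1 : (fun x => ∑ j, (c j : ℂ) * partialDeriv j Φ x - (ν : ℂ) * laplacian Φ x) =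
      (fun x => ∑ j, (c j : ℂ) * partialDeriv j Φ x) - fun x => (ν : ℂ) * laplacian Φ x := rfl
  rw [e1, mFourierCoeff_sub (integrable_finsetSum _ fun j _ => hint j) (hΦ.laplacian.integrable.const_mul _),
    mFourierCoeff_finset_sum _ (fun j _ => hint j)]
  have e2 : ∀ j, mFourierCoeff (fun x => (c j : ℂ) * partialDeriv j Φ x) k =
      (c j : ℂ) * ((2 * Real.pi * Complex.I * (k j)) * mFourierCoeff Φ k) := fun j => by
    rw [show (fun x => (c j : ℂ) * partialDeriv j Φ x) = (c j : ℂ) • partialDeriv j Φ from rfl,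
      mFourierCoeff_const_smul, mFourierCoeff_partialDeriv hΦ j k, smul_eq_mul, smul_eq_mul]
  have e3 : mFourierCoeff (fun x => (ν : ℂ) * laplacian Φ x) k =
      (ν : ℂ) * (-(4 * Real.pi ^ 2 * freqNormSq k : ℝ) * mFourierCoeff Φ k) := by
    rw [show (fun x => (ν : ℂ) * laplacian Φ x) = (ν : ℂ) • laplacian Φ from rfl,
      mFourierCoeff_const_smul, mFourierCoeff_laplacian_complex hΦ k, smul_eq_mul]
  simp_rw [e2]
  rw [e3, driftSymbol]
  push_cast
  have hs : ∑ j, (c j : ℂ) * (2 * Real.pi * I * (k j : ℂ) * mFourierCoeff Φ k) =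
      2 * Real.pi * I * (∑ j, (k j : ℂ) * (c j : ℂ)) * mFourierCoeff Φ k := by
    rw [Finset.mul_sum, Finset.sum_mul]
    exact Finset.sum_congr rfl fun j _ => by ring
  rw [hs]
  ring

omit [DecidableEq d] in
/-- `𝓕h(0) = 0` for a mean-zero real `h`. [folklore] -/
theorem mFourierCoeff_zero_of_hasZeroMean {h : UnitAddTorus d → ℝ} (hmean : HasZeroMean h) :
    mFourierCoeff (fun x => (h x : ℂ)) 0 = 0 := by
  rw [mFourierCoeff_eq_integral_conj_mul]
  simp only [mFourier_zero, ContinuousMap.one_apply, map_one, one_mul]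
  rw [integral_complex_ofReal, hmean, Complex.ofReal_zero]

omit [DecidableEq d] in
/-- `a_k q_k = 𝓕h(k)` for every `k` (mean-zero `h`). [folklore] -/
theorem driftSymbol_mul_driftCoeff {ν : ℝ} (hν : 0 < ν) (c : EuclideanSpace ℝ d) {h : UnitAddTorus d → ℝ}
    (hmean : HasZeroMean h) (k : d → ℤ) :
    driftSymbol ν c k * driftCoeff ν c h k = mFourierCoeff (fun x => (h x : ℂ)) k := by
  by_cases hk : k = 0
  · subst hk
    rw [driftCoeff, if_pos rfl, mul_zero, mFourierCoeff_zero_of_hasZeroMean hmean]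
  · rw [driftCoeff, if_neg hk, mul_div_cancel₀ _ (driftSymbol_ne_zero hν c hk)]

/-- **The complex drift state solves the complex PDE** `∑ⱼ cⱼ ∂ⱼF - νΔF = h`. [folklore] -/
theorem driftStateC_pde {ν : ℝ} (hν : 0 < ν) (c : EuclideanSpace ℝ d) {h : UnitAddTorus d → ℝ}
    (hh : IsSmooth h) (hmean : HasZeroMean h) :
    (fun x => ∑ j, (c j : ℂ) * partialDeriv j (driftStateC ν c h) x - (ν : ℂ) * laplacian (driftStateC ν c h) x) =
      fun x => (h x : ℂ) := by
  have hF := isSmooth_driftStateC hν c hh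
  have hG : IsSmooth (fun x => ∑ j, (c j : ℂ) * partialDeriv j (driftStateC ν c h) x -
      (ν : ℂ) * laplacian (driftStateC ν c h) x) := by
    have e : (fun x => ∑ j, (c j : ℂ) * partialDeriv j (driftStateC ν c h) x -
        (ν : ℂ) * laplacian (driftStateC ν c h) x) =
        (∑ j, (c j) • partialDeriv j (driftStateC ν c h)) - ν • laplacian (driftStateC ν c h) := by
      funext x
      simp only [Pi.sub_apply, Finset.sum_apply, Pi.smul_apply, Complex.real_smul]
    rw [e]
    exact (isSmooth_finset_sum _ fun j _ => (hF.partialDeriv j).smul (c j)).sub (hF.laplacian.smul ν)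
  refine IsSmooth.ext_mFourierCoeff hG hh.ofReal fun k => ?_
  rw [mFourierCoeff_driftOp c hF k, mFourierCoeff_driftStateC hν c hh k, driftSymbol_mul_driftCoeff hν c hmean k]

/-- **The steady drift state solves `c·∇θ_p = νΔθ_p + h` pointwise.** [folklore] -/
theorem driftState_pde {ν : ℝ} (hν : 0 < ν) (c : EuclideanSpace ℝ d) {h : UnitAddTorus d → ℝ}
    (hh : IsSmooth h) (hmean : HasZeroMean h) (x : UnitAddTorus d) :
    ⟪c, gradient (driftState ν c h) x⟫_ℝ = ν * laplacian (driftState ν c h) x + h x := by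
  have hF := isSmooth_driftStateC hν c hh
  have hθ := isSmooth_driftState hν c hh
  have hpde := congrFun (driftStateC_pde hν c hh hmean) x
  simp only at hpde
  have e1 : driftState ν c h = Complex.reCLM ∘ driftStateC ν c h := rfl
  rw [inner_gradient_eq_sum_mul_partialDeriv (hθ.isContDiff (by simp)), e1]
  simp_rw [partialDeriv_clm_comp hF Complex.reCLM]
  rw [laplacian_clm_comp_apply hF Complex.reCLM x]
  simp only [Complex.reCLM_apply]
  have h2 : ∑ j, c j * (partialDeriv j (driftStateC ν c h) x).re =
      (∑ j, (c j : ℂ) * partialDeriv j (driftStateC ν c h) x).re := by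
    rw [Complex.re_sum]
    refine Finset.sum_congr rfl fun j _ => ?_
    rw [Complex.re_ofReal_mul]
  have hA : (∑ j, (c j : ℂ) * partialDeriv j (driftStateC ν c h) x) =
      (h x : ℂ) + (ν : ℂ) * laplacian (driftStateC ν c h) x := by
    rw [← hpde]; ring
  rw [h2, hA, Complex.add_re, Complex.ofReal_re, Complex.re_ofReal_mul]
  ring

/-! ### The drift state as a classical and weak solution; its Fourier coefficients -/

/-- Constant vector fields are divergence free. [folklore] -/
theorem isDivFree_constField (cv : EuclideanSpace ℝ d) : IsDivFree (fun _ : UnitAddTorus d => cv) := by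
  classical
  intro x
  simp [FunctionSpaces.Torus.divergence, FunctionSpaces.Torus.partialDeriv, FunctionSpaces.Torus.lineDeriv]

/-- The steady drift state is a classical steady solution of the forced equation with the constant
velocity field `c`. [folklore] -/
theorem driftState_isClassical {ν : ℝ} (hν : 0 < ν) (c : EuclideanSpace ℝ d) {h : UnitAddTorus d → ℝ}
    (hh : IsSmooth h) (hmean : HasZeroMean h) :
    IsClassicalScalarTransportForcedOn univ ν (fun (_ : ℝ) (_ : UnitAddTorus d) => c)
      (fun _ => h) (fun _ => driftState ν c h) where
  smooth_velocity := contDiffOn_const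
  smooth_source := isSmoothSpaceTimeOn_const hh univ
  smooth_scalar := isSmoothSpaceTimeOn_const (isSmooth_driftState hν c hh) univ
  transport := fun t _ x => by
    have h0 : FunctionSpaces.Torus.timeDerivWithin univ (fun (_ : ℝ) => driftState ν c h) t x = 0 := by
      simp [FunctionSpaces.Torus.timeDerivWithin]
    rw [h0, zero_add, driftState_pde hν c hh hmean x]
  divFree := fun _ _ => isDivFree_constField c

/-- … hence a global weak solution with datum itself. [folklore] -/
theorem driftState_isWeak {ν : ℝ} (hν : 0 < ν) (c : EuclideanSpace ℝ d) {h : UnitAddTorus d → ℝ}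
    (hh : IsSmooth h) (hmean : HasZeroMean h) :
    IsWeakScalarTransportForced ν (fun (_ : ℝ) (_ : UnitAddTorus d) => c) (fun _ => h)
      (driftState ν c h) (fun _ => driftState ν c h) :=
  isWeakScalarTransportForced_of_classical (driftState_isClassical hν c hh hmean)

/-- **Fourier coefficients of the (real) drift state**: `a_k 𝓕θ_p(k) = 𝓕h(k)` (from the PDE,
complexified), hence `𝓕θ_p(k) = q_k` for `k ≠ 0`. [folklore] -/
theorem driftSymbol_mul_mFourierCoeff_driftState {ν : ℝ} (hν : 0 < ν) (c : EuclideanSpace ℝ d)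
    {h : UnitAddTorus d → ℝ} (hh : IsSmooth h) (hmean : HasZeroMean h) (k : d → ℤ) :
    driftSymbol ν c k * mFourierCoeff (fun x => (driftState ν c h x : ℂ)) k = mFourierCoeff (fun x => (h x : ℂ)) k := by
  have hθ := isSmooth_driftState hν c hh
  have hΘ : IsSmooth (fun x => (driftState ν c h x : ℂ)) := hθ.ofReal
  -- the complexified real PDE
  have hpde : (fun x => ∑ j, (c j : ℂ) * partialDeriv j (fun y => (driftState ν c h y : ℂ)) x -
      (ν : ℂ) * laplacian (fun y => (driftState ν c h y : ℂ)) x) = fun x => (h x : ℂ) := by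
    funext x
    have hr := driftState_pde hν c hh hmean x
    rw [inner_gradient_eq_sum_mul_partialDeriv (hθ.isContDiff (by simp))] at hr
    simp_rw [partialDeriv_ofReal_comp hθ]
    rw [← ofReal_laplacian hθ x]
    have := congrArg (fun r : ℝ => (r : ℂ)) hr
    simp only at this
    push_cast at this
    linear_combination this
  have := mFourierCoeff_driftOp (ν := ν) c hΘ k
  rw [hpde] at this
  exact this.symm

theorem mFourierCoeff_driftState {ν : ℝ} (hν : 0 < ν) (c : EuclideanSpace ℝ d)
    {h : UnitAddTorus d → ℝ} (hh : IsSmooth h) (hmean : HasZeroMean h) {k : d → ℤ} (hk : k ≠ 0) :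
    mFourierCoeff (fun x => (driftState ν c h x : ℂ)) k = driftCoeff ν c h k := by
  have h1 := driftSymbol_mul_mFourierCoeff_driftState hν c hh hmean k
  have ha := driftSymbol_ne_zero hν c hk
  rw [driftCoeff, if_neg hk, eq_div_iff ha, mul_comm]
  exact h1

/-! ### Rest-flow machinery generalised to a constant drift `c` -/

section DriftCore

variable {ν : ℝ} {c : EuclideanSpace ℝ d} {h θ₀ : UnitAddTorus d → ℝ} {θ : ℝ → UnitAddTorus d → ℝ}

/-- The fluctuation `θ - θ_p` of a constant-drift witness is a homogeneous weak solution. [folklore] -/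
theorem dtilde_isWeak (hν : 0 < ν) (hh : IsSmooth h) (hmean : HasZeroMean h) (hθ₀ : MemLp θ₀ 2 volume)
    (hweak : IsWeakScalarTransportForced ν (fun (_ : ℝ) (_ : UnitAddTorus d) => c) (fun _ => h) θ₀ θ)
    {T : ℝ} (hT : 0 < T) :
    IsWeakScalarTransportOn T ν (fun (_ : ℝ) (_ : UnitAddTorus d) => c)
      (fun x => θ₀ x - driftState ν c h x) (fun t x => θ t x - driftState ν c h x) :=
  forced_sub (hweak T hT) (driftState_isWeak hν c hh hmean T hT) (hθ₀.integrable one_le_two)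
    (isSmooth_driftState hν c hh).integrable

omit [DecidableEq d] in
/-- Constant velocity fields are bounded (`L^∞` on every strip). [folklore] -/
theorem memLp_top_constField (cv : EuclideanSpace ℝ d) (T : ℝ) :
    MemLp (FunctionSpaces.Torus.stLift fun (_ : ℝ) (_ : UnitAddTorus d) => cv) ∞
      (volume.restrict (Ioo 0 T ×ˢ univ)) := memLp_top_const _

/-- Uniform `L²` bound on the fluctuation (tree energy inequality, bounded velocity). [folklore] -/
theorem dtilde_ae_lintegral_sq_le (hν : 0 < ν) (hh : IsSmooth h) (hmean : HasZeroMean h)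
    (hθ₀ : MemLp θ₀ 2 volume)
    (hweak : IsWeakScalarTransportForced ν (fun (_ : ℝ) (_ : UnitAddTorus d) => c) (fun _ => h) θ₀ θ)
    {T : ℝ} (hT : 0 < T) :
    ∀ᵐ t ∂(volume.restrict (Ioo 0 T)),
      ∫⁻ x, ‖θ t x - driftState ν c h x‖ₑ ^ 2 ≤ ∫⁻ x, ‖θ₀ x - driftState ν c h x‖ₑ ^ 2 := by
  have hdat : MemLp (fun x => θ₀ x - driftState ν c h x) 2 volume :=
    hθ₀.sub ((isSmooth_driftState hν c hh).memLp 2)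
  filter_upwards [IsWeakScalarTransportOn.lintegral_sq_add_le_holds hν (dtilde_isWeak hν hh hmean hθ₀ hweak hT) hdat
    (memLp_top_constField c T)] with t ht
  exact le_of_add_le_left ht

omit [DecidableEq d] in
/-- Fourier coefficients of `θ · r` for a real constant `r`. [folklore] -/
theorem mFourierCoeff_mul_const (f : UnitAddTorus d → ℝ) (r : ℝ) (k : d → ℤ) :
    mFourierCoeff (fun x => ((f x * r : ℝ) : ℂ)) k = (r : ℂ) * mFourierCoeff (fun x => (f x : ℂ)) k := by
  have e : (fun x => ((f x * r : ℝ) : ℂ)) = fun x => r • (f x : ℂ) := by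
    funext x; rw [Complex.real_smul]; push_cast; ring
  rw [e, mFourierCoeff_real_smul]

/-- **Modes of the fluctuation decay exactly** at the complex rate `a_k`:
`𝓕θ̃(t)(k) = e^{-a_k t} 𝓕(θ₀ - θ_p)(k)` for a.e. `t ∈ (0,T)`. [folklore] -/
theorem dtilde_mode_eq (hν : 0 < ν) (hh : IsSmooth h) (hmean : HasZeroMean h) (hθ₀ : MemLp θ₀ 2 volume)
    (hweak : IsWeakScalarTransportForced ν (fun (_ : ℝ) (_ : UnitAddTorus d) => c) (fun _ => h) θ₀ θ)
    {T : ℝ} (hT : 0 < T) (k : d → ℤ) :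
    ∀ᵐ t ∂(volume.restrict (Ioo 0 T)),
      mFourierCoeff (fun x => ((θ t x - driftState ν c h x : ℝ) : ℂ)) k =
        Complex.exp (-(driftSymbol ν c k) * t) *
          mFourierCoeff (fun x => ((θ₀ x - driftState ν c h x : ℝ) : ℂ)) k := by
  have hW := dtilde_isWeak hν hh hmean hθ₀ hweak hT
  have hdat : Integrable (fun x => θ₀ x - driftState ν c h x) volume :=
    (hθ₀.integrable one_le_two).sub (isSmooth_driftState hν c hh).integrable
  have hmode := hW.ae_mFourierCoeff_eq hdat k
  have hz := hW.integrableOn_mFourierCoeff k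
  refine ae_eq_exp_of_volterra (z₀ := mFourierCoeff (fun x => ((θ₀ x - driftState ν c h x : ℝ) : ℂ)) k)
    (a := driftSymbol ν c k) hz ?_
  filter_upwards [hmode] with t ht
  rw [ht]
  congr 1
  refine integral_congr_ae (Eventually.of_forall fun s => ?_)
  simp only
  simp_rw [mFourierCoeff_mul_const]
  set Z := mFourierCoeff (fun x => ((θ s x - driftState ν c h x : ℝ) : ℂ)) k with hZ
  have e : ∑ j, 2 * Real.pi * I * (k j : ℂ) * ((c j : ℂ) * Z) = 2 * Real.pi * I * (∑ j, (k j : ℂ) * (c j : ℂ)) * Z := by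
    rw [Finset.mul_sum, Finset.sum_mul]
    exact Finset.sum_congr rfl fun j _ => by ring
  have e2 : ((∑ i, (k i : ℝ) * c i : ℝ) : ℂ) = ∑ i, (k i : ℂ) * (c i : ℂ) := by push_cast; rfl
  rw [e, driftSymbol, e2]
  ring

omit [DecidableEq d] in
/-- `‖e^{-a_k t}‖ = e^{-4π²ν|k|² t}`. [folklore] -/
theorem norm_cexp_neg_driftSymbol (ν : ℝ) (c : EuclideanSpace ℝ d) (k : d → ℤ) (t : ℝ) :
    ‖Complex.exp (-(driftSymbol ν c k) * t)‖ = Real.exp (-(4 * Real.pi ^ 2 * ν * freqNormSq k) * t) := by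
  rw [Complex.norm_exp]
  congr 1
  have : (-(driftSymbol ν c k) * (t : ℂ)).re = -((driftSymbol ν c k).re) * t := by
    simp [Complex.mul_re]
  rw [this, re_driftSymbol]

/-- Slices of a constant-drift witness: `L²`, and `𝓕θ(t)(k) = 𝓕θ̃(t)(k) + 𝓕θ_p(k)`. [folklore] -/
theorem d_ae_slice (hν : 0 < ν) (hh : IsSmooth h)
    (hweak : IsWeakScalarTransportForced ν (fun (_ : ℝ) (_ : UnitAddTorus d) => c) (fun _ => h) θ₀ θ)
    {T : ℝ} (hT : 0 < T) (k : d → ℤ) :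
    ∀ᵐ t ∂(volume.restrict (Ioo 0 T)), MemLp (θ t) 2 volume ∧
      MemLp (fun x => θ t x - driftState ν c h x) 2 volume ∧
      mFourierCoeff (fun x => (θ t x : ℂ)) k =
        mFourierCoeff (fun x => ((θ t x - driftState ν c h x : ℝ) : ℂ)) k +
          mFourierCoeff (fun x => (driftState ν c h x : ℂ)) k := by
  have hθp : IsSmooth (driftState ν c h) := isSmooth_driftState hν c hh
  filter_upwards [forced_ae_memLp_two (hweak T hT)] with t ht
  have ht' : MemLp (fun x => θ t x - driftState ν c h x) 2 volume := ht.sub (hθp.memLp 2)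
  refine ⟨ht, ht', ?_⟩
  have e : (fun x => (θ t x : ℂ)) = (fun x => ((θ t x - driftState ν c h x : ℝ) : ℂ)) +
      fun x => (driftState ν c h x : ℂ) := by
    funext x; simp
  rw [e, mFourierCoeff_add]
  · exact (ht'.integrable one_le_two).ofReal
  · exact hθp.integrable.ofReal

/-- Honest variance, upper bound, for a constant-drift witness. [folklore] -/
theorem d_ae_scalarL2Sq_le (hν : 0 < ν) (hh : IsSmooth h) (hmean : HasZeroMean h) (hθ₀ : MemLp θ₀ 2 volume)
    (hweak : IsWeakScalarTransportForced ν (fun (_ : ℝ) (_ : UnitAddTorus d) => c) (fun _ => h) θ₀ θ)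
    {T : ℝ} (hT : 0 < T) :
    ∀ᵐ t ∂(volume.restrict (Ioo 0 T)), scalarL2Sq (θ t) ≤
      2 * (∫⁻ x, ‖θ₀ x - driftState ν c h x‖ₑ ^ 2).toReal + 2 * ∫ x, driftState ν c h x ^ 2 := by
  have hθp : IsSmooth (driftState ν c h) := isSmooth_driftState hν c hh
  have hB : ∫⁻ x, ‖θ₀ x - driftState ν c h x‖ₑ ^ 2 < ⊤ := by
    have hB' := lintegral_rpow_enorm_lt_top_of_eLpNorm_lt_top two_ne_zero ENNReal.ofNat_ne_top
      (hθ₀.sub (hθp.memLp 2)).eLpNorm_lt_top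
    convert hB' using 1
    refine lintegral_congr fun x => ?_
    rw [ENNReal.toReal_ofNat, ENNReal.rpow_two]
    rfl
  filter_upwards [d_ae_slice hν hh hweak hT 0, dtilde_ae_lintegral_sq_le hν hh hmean hθ₀ hweak hT]
    with t ⟨ht, ht', _⟩ hlin
  have e1 : ∫ x, (θ t x - driftState ν c h x) ^ 2 ≤ (∫⁻ x, ‖θ₀ x - driftState ν c h x‖ₑ ^ 2).toReal := by
    rw [integral_sq_eq_toReal_lintegral ht']
    exact ENNReal.toReal_mono hB.ne hlin
  have hpt : ∀ x, θ t x ^ 2 ≤ 2 * (θ t x - driftState ν c h x) ^ 2 + 2 * driftState ν c h x ^ 2 :=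
    fun x => by nlinarith [sq_nonneg (θ t x - 2 * driftState ν c h x)]
  have i1 : Integrable (fun x => 2 * (θ t x - driftState ν c h x) ^ 2) volume := ht'.integrable_sq.const_mul 2
  have i2 : Integrable (fun x => 2 * driftState ν c h x ^ 2) volume := ((hθp.memLp 2).integrable_sq).const_mul 2
  calc scalarL2Sq (θ t) = ∫ x, θ t x ^ 2 := rfl
    _ ≤ ∫ x, (2 * (θ t x - driftState ν c h x) ^ 2 + 2 * driftState ν c h x ^ 2) :=
        integral_mono ht.integrable_sq (i1.add i2) hpt
    _ = (2 * ∫ x, (θ t x - driftState ν c h x) ^ 2) + 2 * ∫ x, driftState ν c h x ^ 2 := by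
        rw [integral_add i1 i2, integral_const_mul, integral_const_mul]
    _ ≤ 2 * (∫⁻ x, ‖θ₀ x - driftState ν c h x‖ₑ ^ 2).toReal + 2 * ∫ x, driftState ν c h x ^ 2 := by
        linarith

omit [DecidableEq d] in
/-- **Finite-mode Bessel**: `∑_{k∈F} ‖𝓕θ(k)‖² ≤ ∫ θ²` for `θ ∈ L²`. [folklore] -/
theorem sum_sq_norm_mFourierCoeff_le_integral_sq {f : UnitAddTorus d → ℝ} (hf : MemLp f 2 volume)
    (F : Finset (d → ℤ)) : ∑ k ∈ F, ‖mFourierCoeff (fun x => (f x : ℂ)) k‖ ^ 2 ≤ ∫ x, f x ^ 2 :=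
  sum_le_hasSum F (fun _ _ => sq_nonneg _) (FunctionSpaces.Torus.hasSum_sq_norm_mFourierCoeff_ofReal hf)

/-- **Honest variance, multi-mode lower bound far out in time** for a constant-drift witness: if
for every `k ∈ F` the fluctuation mode has decayed below half the steady mode from `t₁` on, then
`∑_{k∈F} ‖𝓕θ_p(k)‖²/4 ≤ ‖θ(t)‖²` for a.e. `t ∈ (0,T)`, `t ≥ t₁`. [folklore] -/
theorem d_ae_floor (hν : 0 < ν) (hh : IsSmooth h) (hmean : HasZeroMean h) (hθ₀ : MemLp θ₀ 2 volume)
    (hweak : IsWeakScalarTransportForced ν (fun (_ : ℝ) (_ : UnitAddTorus d) => c) (fun _ => h) θ₀ θ)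
    {T : ℝ} (hT : 0 < T) (F : Finset (d → ℤ)) {t₁ : ℝ}
    (ht₁ : ∀ k ∈ F, mFourierCoeff (fun x => (driftState ν c h x : ℂ)) k ≠ 0 → ∀ t, t₁ ≤ t →
      ‖mFourierCoeff (fun x => ((θ₀ x - driftState ν c h x : ℝ) : ℂ)) k‖ *
      Real.exp (-(4 * Real.pi ^ 2 * ν * freqNormSq k) * t) ≤
        ‖mFourierCoeff (fun x => (driftState ν c h x : ℂ)) k‖ / 2) :
    ∀ᵐ t ∂(volume.restrict (Ioo 0 T)), t₁ ≤ t →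
      (∑ k ∈ F, ‖mFourierCoeff (fun x => (driftState ν c h x : ℂ)) k‖ ^ 2) / 4 ≤ scalarL2Sq (θ t) := by
  have hall_slice : ∀ᵐ t ∂(volume.restrict (Ioo 0 T)), ∀ k ∈ F, mFourierCoeff (fun x => (θ t x : ℂ)) k =
      mFourierCoeff (fun x => ((θ t x - driftState ν c h x : ℝ) : ℂ)) k +
        mFourierCoeff (fun x => (driftState ν c h x : ℂ)) k :=
    (F.eventually_all).2 fun k _ => (d_ae_slice hν hh hweak hT k).mono fun t ht => ht.2.2
  have hall_mode : ∀ᵐ t ∂(volume.restrict (Ioo 0 T)), ∀ k ∈ F,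
      mFourierCoeff (fun x => ((θ t x - driftState ν c h x : ℝ) : ℂ)) k =
        Complex.exp (-(driftSymbol ν c k) * t) * mFourierCoeff (fun x => ((θ₀ x - driftState ν c h x : ℝ) : ℂ)) k :=
    (F.eventually_all).2 fun k _ => dtilde_mode_eq hν hh hmean hθ₀ hweak hT k
  filter_upwards [d_ae_slice hν hh hweak hT 0, hall_slice, hall_mode] with t ⟨ht, _, _⟩ hsl hmo htt
  have hB := sum_sq_norm_mFourierCoeff_le_integral_sq ht F
  have hterm : ∀ k ∈ F, ‖mFourierCoeff (fun x => (driftState ν c h x : ℂ)) k‖ ^ 2 / 4 ≤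
      ‖mFourierCoeff (fun x => (θ t x : ℂ)) k‖ ^ 2 := by
    intro k hk
    set P := mFourierCoeff (fun x => (driftState ν c h x : ℂ)) k with hP
    set z₀ := mFourierCoeff (fun x => ((θ₀ x - driftState ν c h x : ℝ) : ℂ)) k with hz₀
    by_cases hP0 : P = 0
    · rw [hP0, norm_zero]; norm_num
    rw [hsl k hk, hmo k hk]
    have hz : ‖Complex.exp (-(driftSymbol ν c k) * t) * z₀‖ ≤ ‖P‖ / 2 := by
      rw [norm_mul, norm_cexp_neg_driftSymbol, mul_comm]
      exact ht₁ k hk hP0 t htt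
    have htri : ‖P‖ - ‖P‖ / 2 ≤ ‖Complex.exp (-(driftSymbol ν c k) * t) * z₀ + P‖ := by
      have := norm_sub_norm_le P (-(Complex.exp (-(driftSymbol ν c k) * t) * z₀))
      rw [norm_neg, sub_neg_eq_add, add_comm] at this
      linarith
    have hP2 : ‖P‖ / 2 ≤ ‖Complex.exp (-(driftSymbol ν c k) * t) * z₀ + P‖ := by linarith
    have hsq := pow_le_pow_left₀ (by positivity) hP2 2
    calc ‖P‖ ^ 2 / 4 = (‖P‖ / 2) ^ 2 := by ring
      _ ≤ _ := hsq
  calc (∑ k ∈ F, ‖mFourierCoeff (fun x => (driftState ν c h x : ℂ)) k‖ ^ 2) / 4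
      = ∑ k ∈ F, ‖mFourierCoeff (fun x => (driftState ν c h x : ℂ)) k‖ ^ 2 / 4 := by
        rw [Finset.sum_div]
    _ ≤ ∑ k ∈ F, ‖mFourierCoeff (fun x => (θ t x : ℂ)) k‖ ^ 2 := Finset.sum_le_sum hterm
    _ ≤ ∫ x, θ t x ^ 2 := hB
    _ = scalarL2Sq (θ t) := rfl

/-- **MULTI-MODE VARIANCE FLOOR** for a constant-drift witness: for every finite set of modes,
`∑_{k∈F} ‖𝓕θ_p(k)‖²/8 ≤ ⟨‖θ‖²⟩`, the long-time average being honest. [folklore] -/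
theorem d_variance_floor (hν : 0 < ν) (hh : IsSmooth h) (hmean : HasZeroMean h) (hθ₀ : MemLp θ₀ 2 volume)
    (hweak : IsWeakScalarTransportForced ν (fun (_ : ℝ) (_ : UnitAddTorus d) => c) (fun _ => h) θ₀ θ)
    (F : Finset (d → ℤ)) (hF : ∀ k ∈ F, k ≠ 0) :
    (∑ k ∈ F, ‖mFourierCoeff (fun x => (driftState ν c h x : ℂ)) k‖ ^ 2) / 8 ≤
      longTimeAvgSup (fun t => scalarL2Sq (θ t)) := by
  set S := ∑ k ∈ F, ‖mFourierCoeff (fun x => (driftState ν c h x : ℂ)) k‖ ^ 2 with hS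
  set M : ℝ := 2 * (∫⁻ x, ‖θ₀ x - driftState ν c h x‖ₑ ^ 2).toReal + 2 * ∫ x, driftState ν c h x ^ 2 with hM
  set g : ℝ → ℝ := fun t => scalarL2Sq (θ t) with hg
  have hg0 : ∀ t, 0 ≤ g t := fun t => scalarL2Sq_nonneg _
  have hS0 : 0 ≤ S := Finset.sum_nonneg fun k _ => sq_nonneg _
  -- decay times, one per mode with nonzero steady coefficient, combined over the finite set
  have hev : ∀ᶠ t : ℝ in atTop, ∀ k ∈ F, mFourierCoeff (fun x => (driftState ν c h x : ℂ)) k ≠ 0 →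
      ‖mFourierCoeff (fun x => ((θ₀ x - driftState ν c h x : ℝ) : ℂ)) k‖ *
        Real.exp (-(4 * Real.pi ^ 2 * ν * freqNormSq k) * t) ≤
          ‖mFourierCoeff (fun x => (driftState ν c h x : ℂ)) k‖ / 2 := by
    refine (F.eventually_all).2 fun k hk => ?_
    set P := mFourierCoeff (fun x => (driftState ν c h x : ℂ)) k
    set z₀ := mFourierCoeff (fun x => ((θ₀ x - driftState ν c h x : ℝ) : ℂ)) k
    set a : ℝ := 4 * Real.pi ^ 2 * ν * freqNormSq k with ha_def
    have ha : 0 < a := by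
      rw [ha_def]
      have := lt_of_lt_of_le one_pos (FunctionSpaces.Torus.one_le_freqNormSq_of_ne_zero (hF k hk))
      positivity
    by_cases hP0 : P = 0
    · exact Eventually.of_forall fun t hne => absurd hP0 hne
    have hP : 0 < ‖P‖ := norm_pos_iff.2 hP0
    have h1 : Tendsto (fun t : ℝ => a * t) atTop atTop := tendsto_id.const_mul_atTop ha
    have h2 : Tendsto (fun t : ℝ => Real.exp (-(a * t))) atTop (nhds 0) :=
      Real.tendsto_exp_neg_atTop_nhds_zero.comp h1
    have h3 : Tendsto (fun t : ℝ => ‖z₀‖ * Real.exp (-a * t)) atTop (nhds (‖z₀‖ * 0)) := by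
      refine (h2.const_mul ‖z₀‖).congr fun t => ?_
      rw [neg_mul]
    rw [mul_zero] at h3
    exact (h3.eventually (Iio_mem_nhds (by positivity : (0 : ℝ) < ‖P‖ / 2))).mono fun t ht _ => ht.le
  obtain ⟨t₀, ht₀⟩ := eventually_atTop.1 hev
  set t₁ : ℝ := max t₀ 0 with ht₁_def
  have ht₁0 : 0 ≤ t₁ := le_max_right _ _
  have ht₁ : ∀ k ∈ F, mFourierCoeff (fun x => (driftState ν c h x : ℂ)) k ≠ 0 → ∀ t, t₁ ≤ t →
      ‖mFourierCoeff (fun x => ((θ₀ x - driftState ν c h x : ℝ) : ℂ)) k‖ *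
        Real.exp (-(4 * Real.pi ^ 2 * ν * freqNormSq k) * t) ≤
          ‖mFourierCoeff (fun x => (driftState ν c h x : ℂ)) k‖ / 2 :=
    fun k hk hne t ht => ht₀ t ((le_max_left _ _).trans ht) k hk hne
  -- Cesàro means: lower and upper bounds
  have hmean_bounds : ∀ T, 2 * t₁ ≤ T → 1 ≤ T → S / 8 ≤ timeMean g T ∧ timeMean g T ≤ M := by
    intro T hT2 hT1
    have hT : 0 < T := by linarith
    have hmeas := aestronglyMeasurable_scalarL2Sq (hweak T hT)
    have hbound := d_ae_scalarL2Sq_le hν hh hmean hθ₀ hweak hT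
    have hint : IntegrableOn g (Ioo 0 T) volume := by
      refine IntegrableOn.of_bound measure_Ioo_lt_top hmeas M ?_
      filter_upwards [hbound] with t ht
      rw [Real.norm_eq_abs, abs_of_nonneg (hg0 t)]
      exact ht
    have htm : timeMean g T = T⁻¹ * ∫ t in Ioo 0 T, g t := by
      rw [timeMean, intervalIntegral.integral_of_le hT.le, integral_Ioc_eq_integral_Ioo]
    constructor
    · have hfloor := d_ae_floor hν hh hmean hθ₀ hweak hT F ht₁
      have hsub : Ioo t₁ T ⊆ Ioo 0 T := Ioo_subset_Ioo_left ht₁0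
      have h1 : ∫ t in Ioo t₁ T, (S / 4 : ℝ) ≤ ∫ t in Ioo t₁ T, g t := by
        refine integral_mono_ae (integrableOn_const (hs := measure_Ioo_lt_top.ne)) (hint.mono_set hsub) ?_
        have hfl' := ae_restrict_of_ae_restrict_of_subset hsub hfloor
        filter_upwards [hfl', ae_restrict_mem measurableSet_Ioo] with t ht htI
        exact ht htI.1.le
      have h2 : ∫ t in Ioo t₁ T, g t ≤ ∫ t in Ioo 0 T, g t :=
        setIntegral_mono_set hint (Eventually.of_forall fun t => hg0 t) (Eventually.of_forall hsub)
      rw [setIntegral_const_Ioo (by linarith) (S / 4)] at h1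
      rw [htm]
      have hTi : 0 < T⁻¹ := inv_pos.2 hT
      have key : T / 2 * (S / 4) ≤ ∫ t in Ioo 0 T, g t := by
        have : T / 2 ≤ T - t₁ := by linarith
        nlinarith
      calc S / 8 = T⁻¹ * (T / 2 * (S / 4)) := by field_simp; ring
        _ ≤ T⁻¹ * ∫ t in Ioo 0 T, g t := mul_le_mul_of_nonneg_left key hTi.le
    · have h1 : ∫ t in Ioo 0 T, g t ≤ ∫ t in Ioo 0 T, (M : ℝ) :=
        integral_mono_ae hint (integrableOn_const (hs := measure_Ioo_lt_top.ne)) hbound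
      rw [setIntegral_const_Ioo hT.le, sub_zero] at h1
      rw [htm]
      calc T⁻¹ * ∫ t in Ioo 0 T, g t ≤ T⁻¹ * (T * M) := mul_le_mul_of_nonneg_left h1 (inv_pos.2 hT).le
        _ = M := by field_simp
  have hfreq : ∃ᶠ T in atTop, S / 8 ≤ timeMean g T := by
    refine Eventually.frequently ?_
    filter_upwards [eventually_ge_atTop (2 * t₁), eventually_ge_atTop (1 : ℝ)] with T h1 h2
    exact (hmean_bounds T h1 h2).1
  have hbdd : IsBoundedUnder (· ≤ ·) atTop (timeMean g) := by
    refine ⟨M, ?_⟩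
    rw [eventually_map]
    filter_upwards [eventually_ge_atTop (2 * t₁), eventually_ge_atTop (1 : ℝ)] with T h1 h2
    exact (hmean_bounds T h1 h2).2
  exact le_limsup_of_frequently_le hfreq hbdd

end DriftCore

/-! ### The dissipation of a constant-drift witness: `limsup ⟨ν‖∇θ‖²⟩ ≤ 8π²ν ∑ₖ |k|² ‖𝓕θ_p(k)‖²` -/

section DriftDissipation

variable {ν : ℝ} {c : EuclideanSpace ℝ d} {h θ₀ : UnitAddTorus d → ℝ} {θ : ℝ → UnitAddTorus d → ℝ}

omit [DecidableEq d] in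
/-- `s ↦ eScalarGradNormSq (θ s)` is a.e.-measurable on `(0,T)` (forced class). [folklore] -/
theorem forced_aemeasurable_eScalarGradNormSq {T κ : ℝ} {u : ℝ → UnitAddTorus d → EuclideanSpace ℝ d}
    {src : ℝ → UnitAddTorus d → ℝ} (hw : IsWeakScalarTransportForcedOn T κ u src θ₀ θ) :
    AEMeasurable (fun s => eScalarGradNormSq (θ s)) ((volume : Measure ℝ).restrict (Ioo 0 T)) := by
  have hcoef : ∀ k : d → ℤ, AEStronglyMeasurable (fun s => mFourierCoeff (fun x => (θ s x : ℂ)) k)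
      ((volume : Measure ℝ).restrict (Ioo 0 T)) := by
    intro k
    have e : (fun s => mFourierCoeff (fun x => (θ s x : ℂ)) k) = fun s => ∫ x, mFourier (-k) x • (θ s x : ℂ) := by
      funext s
      exact FunctionSpaces.Torus.mFourierCoeff_eq_integral_volume _ k
    rw [e]
    have hm : AEStronglyMeasurable (uncurry fun s x => mFourier (-k) x • (θ s x : ℂ))
        (((volume : Measure ℝ).restrict (Ioo 0 T)).prod volume) :=
      ((mFourier (-k)).continuous.comp continuous_snd).aestronglyMeasurable.smul
        (Complex.continuous_ofReal.comp_aestronglyMeasurable (forced_aestronglyMeasurable_uncurry hw))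
    exact hm.integral_prod_right'
  have e : (fun s => eScalarGradNormSq (θ s)) = fun s => ENNReal.ofReal (4 * Real.pi ^ 2) *
      ∑' k : d → ℤ, ENNReal.ofReal (FunctionSpaces.Torus.freqNormSq k) * ‖mFourierCoeff (fun x => (θ s x : ℂ)) k‖ₑ ^ 2 := by
    funext s
    exact eScalarGradNormSq_eq_tsum (θ s)
  rw [e]
  refine AEMeasurable.const_mul (AEMeasurable.tsum fun k => ?_) _
  exact (((hcoef k).enorm.pow_const 2).const_mul _)

omit [Fintype d] [DecidableEq d] in
/-- `‖u + v‖ₑ² ≤ 2‖u‖ₑ² + 2‖v‖ₑ²` in `ℂ`. [folklore] -/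
theorem enorm_add_sq_le (u v : ℂ) : ‖u + v‖ₑ ^ 2 ≤ 2 * ‖u‖ₑ ^ 2 + 2 * ‖v‖ₑ ^ 2 := by
  have e : ∀ w : ℂ, ‖w‖ₑ ^ 2 = ENNReal.ofReal (‖w‖ ^ 2) := fun w => by
    rw [← ofReal_norm, ENNReal.ofReal_pow (norm_nonneg _)]
  have key : ‖u + v‖ ^ 2 ≤ 2 * ‖u‖ ^ 2 + 2 * ‖v‖ ^ 2 := by
    nlinarith [norm_add_le u v, norm_nonneg u, norm_nonneg v, norm_nonneg (u + v), sq_nonneg (‖u‖ - ‖v‖)]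
  calc ‖u + v‖ₑ ^ 2 = ENNReal.ofReal (‖u + v‖ ^ 2) := e _
    _ ≤ ENNReal.ofReal (2 * ‖u‖ ^ 2 + 2 * ‖v‖ ^ 2) := ENNReal.ofReal_le_ofReal key
    _ = 2 * ‖u‖ₑ ^ 2 + 2 * ‖v‖ₑ ^ 2 := by
        rw [ENNReal.ofReal_add (by positivity) (by positivity), ENNReal.ofReal_mul (by norm_num),
          ENNReal.ofReal_mul (by norm_num), ENNReal.ofReal_ofNat, e u, e v]

omit [Fintype d] [DecidableEq d] in
/-- `∫₀ᵀ e^{-bt} dt ≤ 1/b` for `b > 0`, in `ℝ≥0∞`. [folklore] -/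
theorem lintegral_exp_neg_le {b T : ℝ} (hb : 0 < b) (hT : 0 ≤ T) :
    ∫⁻ t in Ioo 0 T, ENNReal.ofReal (Real.exp (-b * t)) ≤ ENNReal.ofReal (1 / b) := by
  have hcont : Continuous fun t : ℝ => Real.exp (-b * t) := Real.continuous_exp.comp (continuous_const.mul continuous_id)
  have hint : IntegrableOn (fun t => Real.exp (-b * t)) (Ioo 0 T) volume :=
    (hcont.integrableOn_Icc).mono_set Ioo_subset_Icc_self
  rw [← ofReal_integral_eq_lintegral_ofReal hint (ae_of_all _ fun t => (Real.exp_pos _).le)]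
  refine ENNReal.ofReal_le_ofReal ?_
  rw [← integral_Ioc_eq_integral_Ioo, ← intervalIntegral.integral_of_le hT]
  have hderiv : ∀ t ∈ uIcc 0 T, HasDerivAt (fun τ => -(Real.exp (-b * τ)) / b) (Real.exp (-b * t)) t := by
    intro t _
    have h1 : HasDerivAt (fun τ => -b * τ) (-b) t := by simpa using (hasDerivAt_id t).const_mul (-b)
    have h2 := h1.exp
    have h3 := (h2.neg).div_const b
    refine h3.congr_deriv ?_
    rw [mul_neg, neg_neg, mul_div_cancel_right₀ _ hb.ne']
  rw [intervalIntegral.integral_eq_sub_of_hasDerivAt hderiv (hcont.intervalIntegrable _ _)]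
  have h0 : Real.exp (-b * T) > 0 := Real.exp_pos _
  rw [mul_zero, Real.exp_zero]
  have : -(Real.exp (-b * T)) / b - -1 / b = (1 - Real.exp (-b * T)) / b := by ring
  rw [this]
  exact div_le_div_of_nonneg_right (by linarith) hb.le

end DriftDissipation

section DriftDissipationMain

variable {ν : ℝ} {c : EuclideanSpace ℝ d} {h θ₀ : UnitAddTorus d → ℝ} {θ : ℝ → UnitAddTorus d → ℝ}

omit [Fintype d] [DecidableEq d] in
/-- Parseval in `ℝ≥0∞`: `∑ₖ ‖𝓕f(k)‖ₑ² = ofReal (∫ f²)` for real `f ∈ L²`. [folklore] -/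
theorem tsum_enorm_sq_mFourierCoeff [Fintype d] {f : UnitAddTorus d → ℝ} (hf : MemLp f 2 volume) :
    ∑' k : d → ℤ, ‖mFourierCoeff (fun x => (f x : ℂ)) k‖ₑ ^ 2 = ENNReal.ofReal (∫ x, f x ^ 2) := by
  have hpar := FunctionSpaces.Torus.hasSum_sq_norm_mFourierCoeff_ofReal hf
  have h1 : ∀ k, ‖mFourierCoeff (fun x => (f x : ℂ)) k‖ₑ ^ 2 = ENNReal.ofReal (‖mFourierCoeff (fun x => (f x : ℂ)) k‖ ^ 2) :=
    fun k => by rw [← ofReal_norm, ENNReal.ofReal_pow (norm_nonneg _)]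
  simp_rw [h1]
  rw [← ENNReal.ofReal_tsum_of_nonneg (fun k => sq_nonneg _) hpar.summable, hpar.tsum_eq]

/-- **Time-integrated gradient bound** for a constant-drift witness: for every `T > 0`,
`∫₀ᵀ ‖∇θ‖² ≤ ‖θ₀ - θ_p‖²/ν + 8π² T ∑ₖ |k|² ‖𝓕θ_p(k)‖²` (modes: `|e^{-a_k t}z_k + P_k|² ≤ 2e^{-8π²ν|k|²t}|z_k|² + 2|P_k|²`,
`∫₀^∞ 8π²|k|² e^{-8π²ν|k|²t} dt = 1/ν`, Parseval). [folklore] -/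
theorem d_lintegral_grad_le (hν : 0 < ν) (hh : IsSmooth h) (hmean : HasZeroMean h) (hθ₀ : MemLp θ₀ 2 volume)
    (hweak : IsWeakScalarTransportForced ν (fun (_ : ℝ) (_ : UnitAddTorus d) => c) (fun _ => h) θ₀ θ)
    {T : ℝ} (hT : 0 < T)
    (hD : Summable fun k : d → ℤ => freqNormSq k * ‖mFourierCoeff (fun x => (driftState ν c h x : ℂ)) k‖ ^ 2) :
    ∫⁻ t in Ioo 0 T, eScalarGradNormSq (θ t) ≤
      ENNReal.ofReal ((∫ x, (θ₀ x - driftState ν c h x) ^ 2) / ν +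
        8 * Real.pi ^ 2 * T * ∑' k, freqNormSq k * ‖mFourierCoeff (fun x => (driftState ν c h x : ℂ)) k‖ ^ 2) := by
  set P : (d → ℤ) → ℂ := fun k => mFourierCoeff (fun x => (driftState ν c h x : ℂ)) k with hP
  set z : (d → ℤ) → ℂ := fun k => mFourierCoeff (fun x => ((θ₀ x - driftState ν c h x : ℝ) : ℂ)) k with hz
  set a : (d → ℤ) → ℝ := fun k => 4 * Real.pi ^ 2 * ν * freqNormSq k with ha
  set D : ℝ := ∑' k, freqNormSq k * ‖P k‖ ^ 2 with hDdef
  set V : ℝ := ∫ x, (θ₀ x - driftState ν c h x) ^ 2 with hV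
  have hθp : IsSmooth (driftState ν c h) := isSmooth_driftState hν c hh
  have hdat : MemLp (fun x => θ₀ x - driftState ν c h x) 2 volume := hθ₀.sub (hθp.memLp 2)
  -- (1) simultaneous modal formula, a.e. in `t`
  have hall : ∀ᵐ t ∂((volume : Measure ℝ).restrict (Ioo 0 T)), ∀ k : d → ℤ,
      mFourierCoeff (fun x => (θ t x : ℂ)) k = Complex.exp (-(driftSymbol ν c k) * t) * z k + P k := by
    refine ae_all_iff.2 fun k => ?_
    filter_upwards [d_ae_slice hν hh hweak hT k, dtilde_mode_eq hν hh hmean hθ₀ hweak hT k] with t ht hm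
    rw [ht.2.2, hm]
  -- (2) the explicit bound function
  set Bf : ℝ → ℝ≥0∞ := fun t => ENNReal.ofReal (4 * Real.pi ^ 2) *
    ∑' k, ENNReal.ofReal (freqNormSq k) * (2 * ENNReal.ofReal (Real.exp (-(2 * a k) * t)) * ‖z k‖ₑ ^ 2 + 2 * ‖P k‖ₑ ^ 2) with hBf
  have hGB : ∀ᵐ t ∂((volume : Measure ℝ).restrict (Ioo 0 T)), eScalarGradNormSq (θ t) ≤ Bf t := by
    filter_upwards [hall] with t ht
    rw [eScalarGradNormSq_eq_tsum]
    simp only [hBf]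
    have hterm : ∀ k, ENNReal.ofReal (freqNormSq k) * ‖mFourierCoeff (fun x => (θ t x : ℂ)) k‖ₑ ^ 2 ≤
        ENNReal.ofReal (freqNormSq k) * (2 * ENNReal.ofReal (Real.exp (-(2 * a k) * t)) * ‖z k‖ₑ ^ 2 + 2 * ‖P k‖ₑ ^ 2) := by
      intro k
      rw [ht k]
      have hexp2 : Real.exp (-(a k) * t) ^ 2 = Real.exp (-(2 * a k) * t) := by
        rw [← Real.exp_nat_mul]; congr 1; push_cast; ring
      have e3 : ‖Complex.exp (-(driftSymbol ν c k) * t) * z k‖ₑ ^ 2 = ENNReal.ofReal (Real.exp (-(2 * a k) * t)) * ‖z k‖ₑ ^ 2 := by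
        rw [enorm_mul, mul_pow, ← ofReal_norm, norm_cexp_neg_driftSymbol, ← ENNReal.ofReal_pow (Real.exp_pos _).le]
        simp only [ha] at hexp2 ⊢
        rw [hexp2]
      have h4 := enorm_add_sq_le (Complex.exp (-(driftSymbol ν c k) * t) * z k) (P k)
      rw [e3, ← mul_assoc] at h4
      exact mul_le_mul_right h4 _
    exact mul_le_mul_right (ENNReal.tsum_le_tsum hterm) _
  -- (3) integrate the bound termwise
  have hmeas_term : ∀ k, Measurable fun t : ℝ => ENNReal.ofReal (freqNormSq k) *
      (2 * ENNReal.ofReal (Real.exp (-(2 * a k) * t)) * ‖z k‖ₑ ^ 2 + 2 * ‖P k‖ₑ ^ 2) := by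
    intro k
    have : Measurable fun t : ℝ => ENNReal.ofReal (Real.exp (-(2 * a k) * t)) :=
      ENNReal.measurable_ofReal.comp (Real.continuous_exp.comp (continuous_const.mul continuous_id)).measurable
    exact ((this.const_mul _).mul_const _ |>.add_const _ |>.const_mul _)
  have hint_term : ∀ k, ∫⁻ t in Ioo 0 T, ENNReal.ofReal (freqNormSq k) *
      (2 * ENNReal.ofReal (Real.exp (-(2 * a k) * t)) * ‖z k‖ₑ ^ 2 + 2 * ‖P k‖ₑ ^ 2) ≤
      ENNReal.ofReal (1 / (4 * Real.pi ^ 2 * ν)) * ‖z k‖ₑ ^ 2 + ENNReal.ofReal (2 * T * (freqNormSq k * ‖P k‖ ^ 2)) := by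
    intro k
    have hmexp : Measurable fun t : ℝ => ENNReal.ofReal (Real.exp (-(2 * a k) * t)) :=
      ENNReal.measurable_ofReal.comp (Real.continuous_exp.comp (continuous_const.mul continuous_id)).measurable
    rw [lintegral_const_mul _ (((hmexp.const_mul _).mul_const _).add_const _),
      lintegral_add_right _ measurable_const, lintegral_mul_const _ (hmexp.const_mul _),
      lintegral_const_mul _ hmexp, setLIntegral_const, Real.volume_Ioo]
    by_cases hk : k = 0
    · subst hk
      simp [FunctionSpaces.Torus.freqNormSq]
    have hfk : 0 < freqNormSq k := lt_of_lt_of_le one_pos (FunctionSpaces.Torus.one_le_freqNormSq_of_ne_zero hk)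
    have hak : 0 < a k := by simp only [ha]; positivity
    have hI := lintegral_exp_neg_le (b := 2 * a k) (T := T) (by positivity) hT.le
    have e2 : ‖P k‖ₑ ^ 2 = ENNReal.ofReal (‖P k‖ ^ 2) := by rw [← ofReal_norm, ENNReal.ofReal_pow (norm_nonneg _)]
    calc ENNReal.ofReal (freqNormSq k) * (2 * (∫⁻ t in Ioo 0 T, ENNReal.ofReal (Real.exp (-(2 * a k) * t))) * ‖z k‖ₑ ^ 2 +
          2 * ‖P k‖ₑ ^ 2 * ENNReal.ofReal (T - 0))
        ≤ ENNReal.ofReal (freqNormSq k) * (2 * ENNReal.ofReal (1 / (2 * a k)) * ‖z k‖ₑ ^ 2 +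
          2 * ‖P k‖ₑ ^ 2 * ENNReal.ofReal (T - 0)) := by gcongr
      _ = ENNReal.ofReal (freqNormSq k * (2 * (1 / (2 * a k)))) * ‖z k‖ₑ ^ 2 +
          ENNReal.ofReal (2 * T * (freqNormSq k * ‖P k‖ ^ 2)) := by
          rw [mul_add, sub_zero, e2, ← ENNReal.ofReal_ofNat 2, ← ENNReal.ofReal_mul (by norm_num),
            ← mul_assoc, ← ENNReal.ofReal_mul hfk.le]
          congr 1
          rw [show ENNReal.ofReal (freqNormSq k) * (ENNReal.ofReal 2 * ENNReal.ofReal (‖P k‖ ^ 2) * ENNReal.ofReal T) =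
            ENNReal.ofReal (freqNormSq k * (2 * ‖P k‖ ^ 2 * T)) by
              rw [← ENNReal.ofReal_mul (by norm_num), ← ENNReal.ofReal_mul (by positivity), ← ENNReal.ofReal_mul hfk.le]]
          congr 1
          ring
      _ = ENNReal.ofReal (1 / (4 * Real.pi ^ 2 * ν)) * ‖z k‖ₑ ^ 2 +
          ENNReal.ofReal (2 * T * (freqNormSq k * ‖P k‖ ^ 2)) := by
          congr 2
          simp only [ha]
          field_simp
  -- sum over `k`
  have hsum : ∫⁻ t in Ioo 0 T, Bf t ≤ ENNReal.ofReal (4 * Real.pi ^ 2) *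
      (ENNReal.ofReal (1 / (4 * Real.pi ^ 2 * ν)) * ENNReal.ofReal V + ENNReal.ofReal (2 * T * D)) := by
    simp only [hBf]
    rw [lintegral_const_mul' _ _ ENNReal.ofReal_ne_top, lintegral_tsum fun k => (hmeas_term k).aemeasurable]
    refine mul_le_mul_right ?_ _
    calc ∑' k, ∫⁻ t in Ioo 0 T, ENNReal.ofReal (freqNormSq k) *
          (2 * ENNReal.ofReal (Real.exp (-(2 * a k) * t)) * ‖z k‖ₑ ^ 2 + 2 * ‖P k‖ₑ ^ 2)
        ≤ ∑' k, (ENNReal.ofReal (1 / (4 * Real.pi ^ 2 * ν)) * ‖z k‖ₑ ^ 2 +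
          ENNReal.ofReal (2 * T * (freqNormSq k * ‖P k‖ ^ 2))) := ENNReal.tsum_le_tsum hint_term
      _ = ENNReal.ofReal (1 / (4 * Real.pi ^ 2 * ν)) * ENNReal.ofReal V + ENNReal.ofReal (2 * T * D) := by
          rw [ENNReal.tsum_add, ENNReal.tsum_mul_left, tsum_enorm_sq_mFourierCoeff hdat]
          congr 1
          rw [← ENNReal.ofReal_tsum_of_nonneg (fun k => by have := freqNormSq_nonneg k; positivity) (hD.mul_left (2 * T))]
          congr 1
          rw [tsum_mul_left]
  -- conclude
  calc ∫⁻ t in Ioo 0 T, eScalarGradNormSq (θ t) ≤ ∫⁻ t in Ioo 0 T, Bf t := lintegral_mono_ae hGB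
    _ ≤ ENNReal.ofReal (4 * Real.pi ^ 2) *
        (ENNReal.ofReal (1 / (4 * Real.pi ^ 2 * ν)) * ENNReal.ofReal V + ENNReal.ofReal (2 * T * D)) := hsum
    _ = ENNReal.ofReal (V / ν + 8 * Real.pi ^ 2 * T * D) := by
        have hV0 : 0 ≤ V := integral_nonneg fun _ => sq_nonneg _
        have hD0 : 0 ≤ D := tsum_nonneg fun k => by have := freqNormSq_nonneg k; positivity
        rw [← ENNReal.ofReal_mul (by positivity), ← ENNReal.ofReal_add (by positivity) (by positivity),
          ← ENNReal.ofReal_mul (by positivity)]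
        congr 1
        field_simp
        ring

end DriftDissipationMain

section DriftLimsup

variable {ν : ℝ} {c : EuclideanSpace ℝ d} {h θ₀ : UnitAddTorus d → ℝ} {θ : ℝ → UnitAddTorus d → ℝ}

/-- **DISSIPATION CEILING** of a constant-drift witness:
`⟨ν‖∇θ‖²⟩ ≤ 8π²ν ∑ₖ |k|² ‖𝓕θ_p(k)‖²` (transients average out). [folklore] -/
theorem d_dissipation_limsup_le (hν : 0 < ν) (hh : IsSmooth h) (hmean : HasZeroMean h) (hθ₀ : MemLp θ₀ 2 volume)
    (hweak : IsWeakScalarTransportForced ν (fun (_ : ℝ) (_ : UnitAddTorus d) => c) (fun _ => h) θ₀ θ)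
    (hD : Summable fun k : d → ℤ => freqNormSq k * ‖mFourierCoeff (fun x => (driftState ν c h x : ℂ)) k‖ ^ 2) :
    longTimeAvgSup (fun t => ν * (eScalarGradNormSq (θ t)).toReal) ≤
      8 * Real.pi ^ 2 * ν * ∑' k, freqNormSq k * ‖mFourierCoeff (fun x => (driftState ν c h x : ℂ)) k‖ ^ 2 := by
  set D : ℝ := ∑' k, freqNormSq k * ‖mFourierCoeff (fun x => (driftState ν c h x : ℂ)) k‖ ^ 2 with hDdef
  set V : ℝ := ∫ x, (θ₀ x - driftState ν c h x) ^ 2 with hV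
  set G : ℝ → ℝ≥0∞ := fun t => eScalarGradNormSq (θ t) with hG
  set gd : ℝ → ℝ := fun t => ν * (G t).toReal with hgd
  have hgd0 : ∀ t, 0 ≤ gd t := fun t => mul_nonneg hν.le ENNReal.toReal_nonneg
  have hV0 : 0 ≤ V := integral_nonneg fun _ => sq_nonneg _
  have hD0 : 0 ≤ D := tsum_nonneg fun k => by have := freqNormSq_nonneg k; positivity
  have hmean_le : ∀ T, 0 < T → timeMean gd T ≤ V / T + 8 * Real.pi ^ 2 * ν * D := by
    intro T hT
    have hL := d_lintegral_grad_le hν hh hmean hθ₀ hweak hT hD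
    have hLfin : ∫⁻ t in Ioo 0 T, G t < ⊤ := lt_of_le_of_lt hL ENNReal.ofReal_lt_top
    have hGm : AEMeasurable G (volume.restrict (Ioo 0 T)) := forced_aemeasurable_eScalarGradNormSq (hweak T hT)
    have hint : ∫ t in Ioo 0 T, (G t).toReal = (∫⁻ t in Ioo 0 T, G t).toReal :=
      integral_toReal hGm (ae_lt_top' hGm hLfin.ne)
    have htm : timeMean gd T = T⁻¹ * (ν * (∫⁻ t in Ioo 0 T, G t).toReal) := by
      rw [timeMean, intervalIntegral.integral_of_le hT.le, integral_Ioc_eq_integral_Ioo]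
      simp only [hgd]
      rw [integral_const_mul, hint]
    rw [htm]
    have h2 : (∫⁻ t in Ioo 0 T, G t).toReal ≤ V / ν + 8 * Real.pi ^ 2 * T * D := by
      have := ENNReal.toReal_mono ENNReal.ofReal_ne_top hL
      rwa [ENNReal.toReal_ofReal (by positivity)] at this
    calc T⁻¹ * (ν * (∫⁻ t in Ioo 0 T, G t).toReal) ≤ T⁻¹ * (ν * (V / ν + 8 * Real.pi ^ 2 * T * D)) := by
          gcongr
      _ = V / T + 8 * Real.pi ^ 2 * ν * D := by field_simp
  refine le_of_forall_pos_le_add fun δ hδ => ?_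
  have hcb : IsCoboundedUnder (· ≤ ·) atTop (timeMean gd) :=
    isCoboundedUnder_le_of_eventually_le atTop
      ((eventually_ge_atTop (0 : ℝ)).mono fun T hT => timeMean_nonneg hgd0 hT)
  refine limsup_le_of_le hcb ?_
  filter_upwards [eventually_gt_atTop (0 : ℝ), eventually_ge_atTop (V / δ + 1)] with T hT hTB
  refine (hmean_le T hT).trans ?_
  have : V / T ≤ δ := by
    rw [div_le_iff₀ hT]
    have h1 : V / δ < T := by linarith
    rw [div_lt_iff₀ hδ] at h1
    linarith
  linarith

/-- The steady coefficients are square-summable against `|k|²`: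
`∑ₖ |k|² ‖𝓕θ_p(k)‖² ≤ (4π²ν)⁻² ∑ₖ ‖𝓕h(k)‖² < ∞`. [folklore] -/
theorem summable_freqNormSq_mul_sq (hν : 0 < ν) (c : EuclideanSpace ℝ d) (hh : IsSmooth h) (hmean : HasZeroMean h) :
    Summable fun k : d → ℤ => freqNormSq k * ‖mFourierCoeff (fun x => (driftState ν c h x : ℂ)) k‖ ^ 2 := by
  have hpar := FunctionSpaces.Torus.hasSum_sq_norm_mFourierCoeff_ofReal (hh.memLp 2)
  refine Summable.of_nonneg_of_le (fun k => by have := freqNormSq_nonneg k; positivity) (fun k => ?_)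
    (hpar.summable.mul_left ((4 * Real.pi ^ 2 * ν) ^ 2)⁻¹)
  by_cases hk : k = 0
  · subst hk; simp [FunctionSpaces.Torus.freqNormSq]; positivity
  have hfk : 1 ≤ freqNormSq k := FunctionSpaces.Torus.one_le_freqNormSq_of_ne_zero hk
  rw [mFourierCoeff_driftState hν c hh hmean hk]
  have hq := norm_driftCoeff_le hν c h hk
  have hq0 : 0 ≤ ‖driftCoeff ν c h k‖ := norm_nonneg _
  set N := ‖mFourierCoeff (fun x => (h x : ℂ)) k‖ with hN
  have hN0 : 0 ≤ N := norm_nonneg _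
  have hden : 0 < 4 * Real.pi ^ 2 * ν * freqNormSq k := by positivity
  calc freqNormSq k * ‖driftCoeff ν c h k‖ ^ 2 ≤ freqNormSq k * (N / (4 * Real.pi ^ 2 * ν * freqNormSq k)) ^ 2 := by
        gcongr
    _ = N ^ 2 / ((4 * Real.pi ^ 2 * ν) ^ 2 * freqNormSq k) := by field_simp
    _ ≤ N ^ 2 / ((4 * Real.pi ^ 2 * ν) ^ 2 * 1) := by
        apply div_le_div_of_nonneg_left (by positivity) (by positivity)
        gcongr
    _ = ((4 * Real.pi ^ 2 * ν) ^ 2)⁻¹ * N ^ 2 := by ring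

end DriftLimsup

section DriftNoGo

variable {ν : ℝ} {c : EuclideanSpace ℝ d} {h θ₀ : UnitAddTorus d → ℝ} {θ : ℝ → UnitAddTorus d → ℝ}

/-- From the multi-mode variance floors: the steady coefficients (off the zero mode) are
square-summable with `∑ₖ≠0 ‖𝓕θ_p(k)‖² ≤ 8E`. [folklore] -/
theorem tsum_sq_coeff_le (hν : 0 < ν) (hh : IsSmooth h) (hmean : HasZeroMean h) (hθ₀ : MemLp θ₀ 2 volume)
    (hweak : IsWeakScalarTransportForced ν (fun (_ : ℝ) (_ : UnitAddTorus d) => c) (fun _ => h) θ₀ θ)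
    {E : ℝ} (hE : longTimeAvgSup (fun t => scalarL2Sq (θ t)) ≤ E) :
    Summable (fun k : d → ℤ => if k = 0 then 0 else ‖mFourierCoeff (fun x => (driftState ν c h x : ℂ)) k‖ ^ 2) ∧
      ∑' k : d → ℤ, (if k = 0 then 0 else ‖mFourierCoeff (fun x => (driftState ν c h x : ℂ)) k‖ ^ 2) ≤ 8 * E := by
  set X : (d → ℤ) → ℝ := fun k => if k = 0 then 0 else ‖mFourierCoeff (fun x => (driftState ν c h x : ℂ)) k‖ ^ 2 with hX
  have hX0 : ∀ k, 0 ≤ X k := fun k => by simp only [hX]; split_ifs <;> positivity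
  have hF : ∀ F : Finset (d → ℤ), ∑ k ∈ F, X k ≤ 8 * E := by
    intro F
    classical
    have hsum : ∑ k ∈ F, X k = ∑ k ∈ F.filter (· ≠ 0), ‖mFourierCoeff (fun x => (driftState ν c h x : ℂ)) k‖ ^ 2 := by
      rw [Finset.sum_filter]
      refine Finset.sum_congr rfl fun k _ => ?_
      simp only [hX]
      split_ifs with hk <;> simp_all
    rw [hsum]
    have hfl := d_variance_floor hν hh hmean hθ₀ hweak (F.filter (· ≠ 0)) (fun k hk => (Finset.mem_filter.1 hk).2)
    linarith [hfl.trans hE]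
  have hs : Summable X := summable_of_sum_le hX0 hF
  exact ⟨hs, hs.tsum_le_of_sum_le hF⟩

/-- The spectral TAIL of the source: `tail Λ = ∑_{|k|² > Λ} ‖𝓕h(k)‖²`. [folklore] -/
def sourceTail (h : UnitAddTorus d → ℝ) (Λ : ℝ) : ℝ :=
  ∑' k : d → ℤ, if Λ < freqNormSq k then ‖mFourierCoeff (fun x => (h x : ℂ)) k‖ ^ 2 else 0

omit [DecidableEq d] in
theorem sourceTail_nonneg (h : UnitAddTorus d → ℝ) (Λ : ℝ) : 0 ≤ sourceTail h Λ :=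
  tsum_nonneg fun k => by split_ifs <;> positivity

omit [DecidableEq d] in
theorem summable_sourceTail_term {h : UnitAddTorus d → ℝ} (hh : IsSmooth h) (Λ : ℝ) :
    Summable fun k : d → ℤ => if Λ < freqNormSq k then ‖mFourierCoeff (fun x => (h x : ℂ)) k‖ ^ 2 else 0 := by
  have hpar := FunctionSpaces.Torus.hasSum_sq_norm_mFourierCoeff_ofReal (hh.memLp 2)
  refine Summable.of_nonneg_of_le (fun k => by split_ifs <;> positivity) (fun k => ?_) hpar.summable
  split_ifs <;> simp

omit [DecidableEq d] in
/-- **The tail vanishes**: `tail Λ → 0` as `Λ → ∞` (`h ∈ L²`). [folklore] -/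
theorem sourceTail_small {h : UnitAddTorus d → ℝ} (hh : IsSmooth h) {η : ℝ} (hη : 0 < η) :
    ∃ Λ₀ : ℝ, 0 < Λ₀ ∧ ∀ Λ, Λ₀ ≤ Λ → sourceTail h Λ ≤ η := by
  classical
  have hpar := FunctionSpaces.Torus.hasSum_sq_norm_mFourierCoeff_ofReal (hh.memLp 2)
  set N2 : (d → ℤ) → ℝ := fun k => ‖mFourierCoeff (fun x => (h x : ℂ)) k‖ ^ 2 with hN2
  have htend := tendsto_tsum_compl_atTop_zero N2
  obtain ⟨S, hS⟩ := (eventually_atTop.1 (htend.eventually (Iio_mem_nhds hη)))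
  have hS' : ∑' k : {x // x ∉ S}, N2 k < η := hS S le_rfl
  refine ⟨∑ k ∈ S, freqNormSq k + 1, by have := Finset.sum_nonneg (fun k (_ : k ∈ S) => freqNormSq_nonneg k); linarith,
    fun Λ hΛ => ?_⟩
  have hmem : ∀ k, Λ < freqNormSq k → k ∉ S := by
    intro k hk hkS
    have : freqNormSq k ≤ ∑ k ∈ S, freqNormSq k := Finset.single_le_sum (fun k _ => freqNormSq_nonneg k) hkS
    linarith
  have hle : sourceTail h Λ ≤ ∑' k, ((↑S : Set (d → ℤ))ᶜ).indicator N2 k := by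
    unfold sourceTail
    refine Summable.tsum_le_tsum (fun k => ?_) (summable_sourceTail_term hh Λ) (hpar.summable.indicator _)
    split_ifs with hk
    · rw [Set.indicator_of_mem (by simpa using hmem k hk)]
    · exact Set.indicator_nonneg (fun _ _ => by positivity) _
  rw [← tsum_subtype] at hle
  exact hle.trans hS'.le

end DriftNoGo

section DriftAssembly

variable {ν : ℝ} {c : EuclideanSpace ℝ d} {h θ₀ : UnitAddTorus d → ℝ} {θ : ℝ → UnitAddTorus d → ℝ}

/-- **K-SPLIT** of the dissipation sum at the threshold `Λ`:
`∑ₖ |k|² ‖𝓕θ_p(k)‖² ≤ Λ ∑ₖ≠0 ‖𝓕θ_p(k)‖² + tail(Λ)/((4π²ν)²Λ)`. [folklore] -/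
theorem dissipationSum_le_split (hν : 0 < ν) (c : EuclideanSpace ℝ d) (hh : IsSmooth h) (hmean : HasZeroMean h)
    {Λ : ℝ} (hΛ : 0 < Λ)
    (hX : Summable fun k : d → ℤ => if k = 0 then 0 else ‖mFourierCoeff (fun x => (driftState ν c h x : ℂ)) k‖ ^ 2) :
    ∑' k, freqNormSq k * ‖mFourierCoeff (fun x => (driftState ν c h x : ℂ)) k‖ ^ 2 ≤
      Λ * ∑' k : d → ℤ, (if k = 0 then 0 else ‖mFourierCoeff (fun x => (driftState ν c h x : ℂ)) k‖ ^ 2) +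
        sourceTail h Λ / ((4 * Real.pi ^ 2 * ν) ^ 2 * Λ) := by
  set P : (d → ℤ) → ℂ := fun k => mFourierCoeff (fun x => (driftState ν c h x : ℂ)) k with hP
  set N2 : (d → ℤ) → ℝ := fun k => ‖mFourierCoeff (fun x => (h x : ℂ)) k‖ ^ 2 with hN2
  have hC : 0 < (4 * Real.pi ^ 2 * ν) ^ 2 * Λ := by positivity
  have hterm : ∀ k, freqNormSq k * ‖P k‖ ^ 2 ≤
      Λ * (if k = 0 then 0 else ‖P k‖ ^ 2) + (if Λ < freqNormSq k then N2 k else 0) / ((4 * Real.pi ^ 2 * ν) ^ 2 * Λ) := by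
    intro k
    by_cases hk : k = 0
    · subst hk
      simp [FunctionSpaces.Torus.freqNormSq]
      positivity
    rw [if_neg hk]
    by_cases hlt : Λ < freqNormSq k
    · rw [if_pos hlt]
      have hfk : 0 < freqNormSq k := hΛ.trans hlt
      have hq : ‖P k‖ ≤ ‖mFourierCoeff (fun x => (h x : ℂ)) k‖ / (4 * Real.pi ^ 2 * ν * freqNormSq k) := by
        simp only [hP]
        rw [mFourierCoeff_driftState hν c hh hmean hk]
        exact norm_driftCoeff_le hν c h hk
      have hq0 : 0 ≤ ‖P k‖ := norm_nonneg _
      have hNk : 0 ≤ ‖mFourierCoeff (fun x => (h x : ℂ)) k‖ := norm_nonneg _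
      have h1 : freqNormSq k * ‖P k‖ ^ 2 ≤ N2 k / ((4 * Real.pi ^ 2 * ν) ^ 2 * freqNormSq k) := by
        calc freqNormSq k * ‖P k‖ ^ 2
            ≤ freqNormSq k * (‖mFourierCoeff (fun x => (h x : ℂ)) k‖ / (4 * Real.pi ^ 2 * ν * freqNormSq k)) ^ 2 := by gcongr
          _ = N2 k / ((4 * Real.pi ^ 2 * ν) ^ 2 * freqNormSq k) := by simp only [hN2]; field_simp
      have h2 : N2 k / ((4 * Real.pi ^ 2 * ν) ^ 2 * freqNormSq k) ≤ N2 k / ((4 * Real.pi ^ 2 * ν) ^ 2 * Λ) := by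
        apply div_le_div_of_nonneg_left (by positivity) hC
        gcongr
      have h3 : 0 ≤ Λ * ‖P k‖ ^ 2 := by positivity
      linarith
    · rw [if_neg hlt]
      have hle : freqNormSq k ≤ Λ := not_lt.1 hlt
      have : freqNormSq k * ‖P k‖ ^ 2 ≤ Λ * ‖P k‖ ^ 2 := mul_le_mul_of_nonneg_right hle (sq_nonneg _)
      simpa using this
  have hs1 := summable_freqNormSq_mul_sq hν c hh hmean
  have hs2 : Summable fun k : d → ℤ => Λ * (if k = 0 then 0 else ‖P k‖ ^ 2) +
      (if Λ < freqNormSq k then N2 k else 0) / ((4 * Real.pi ^ 2 * ν) ^ 2 * Λ) :=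
    (hX.mul_left Λ).add ((summable_sourceTail_term hh Λ).div_const _)
  calc ∑' k, freqNormSq k * ‖P k‖ ^ 2
      ≤ ∑' k, (Λ * (if k = 0 then 0 else ‖P k‖ ^ 2) +
        (if Λ < freqNormSq k then N2 k else 0) / ((4 * Real.pi ^ 2 * ν) ^ 2 * Λ)) := Summable.tsum_le_tsum hterm hs1 hs2
    _ = Λ * ∑' k : d → ℤ, (if k = 0 then 0 else ‖P k‖ ^ 2) + sourceTail h Λ / ((4 * Real.pi ^ 2 * ν) ^ 2 * Λ) := by
        rw [(hX.mul_left Λ).tsum_add ((summable_sourceTail_term hh Λ).div_const _), tsum_mul_left, tsum_div_const]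
        rfl

/-- **CONSTANT-DRIFT NO-GO (refuted strengthening of the crux).** No family of weak solutions of the
sourced advection–diffusion equation with CONSTANT drifts `v_j ≡ c_j` (Galilean states), `ν_j → 0`,
`L²` data, one smooth mean-zero source and `j`-uniformly bounded mean variance can have a `j`-uniform
positive floor under its mean dissipation: the variance bound caps `∑ₖ≠0 ‖𝓕θ_{p,j}(k)‖² ≤ 8E`, the
dissipation ceiling and the K-split at `Λ = μ/ν_j` give `⟨ν_j‖∇θ_j‖²⟩ ≤ 64π²μE + tail(μ/ν_j)/(2π²μ)`,
small for `μ` small and then `j` large. [folklore] -/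
theorem constantDrift_not_anomalous (hh : IsSmooth h) (hmean : HasZeroMean h) {νs : ℕ → ℝ}
    (hν : ∀ j, 0 < νs j) (hν0 : Tendsto νs atTop (nhds 0)) {cs : ℕ → EuclideanSpace ℝ d}
    {θ₀s : ℕ → UnitAddTorus d → ℝ} (hθ₀ : ∀ j, MemLp (θ₀s j) 2 volume) {θs : ℕ → ℝ → UnitAddTorus d → ℝ}
    (hweak : ∀ j, IsWeakScalarTransportForced (νs j) (fun (_ : ℝ) (_ : UnitAddTorus d) => cs j)
      (fun _ => h) (θ₀s j) (θs j))
    {E : ℝ} (hV : ∀ j, longTimeAvgSup (fun t => scalarL2Sq (θs j t)) ≤ E) :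
    ¬ ∃ ε : ℝ, 0 < ε ∧ ∀ j, ε ≤ longTimeAvgSup (fun t => νs j * (eScalarGradNormSq (θs j t)).toReal) := by
  rintro ⟨ε, hε, hfl⟩
  have hE0 : 0 ≤ E := (longTimeAvgSup_nonneg fun t => scalarL2Sq_nonneg (θs 0 t)).trans (hV 0)
  set μ : ℝ := ε / (4 * (64 * Real.pi ^ 2 * E + 1)) with hμ
  have hμ0 : 0 < μ := by rw [hμ]; positivity
  have h64 : 64 * Real.pi ^ 2 * μ * E ≤ ε / 4 := by
    rw [hμ]
    rw [show 64 * Real.pi ^ 2 * (ε / (4 * (64 * Real.pi ^ 2 * E + 1))) * E =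
      ε / 4 * (64 * Real.pi ^ 2 * E / (64 * Real.pi ^ 2 * E + 1)) by field_simp]
    have : 64 * Real.pi ^ 2 * E / (64 * Real.pi ^ 2 * E + 1) ≤ 1 := by
      rw [div_le_one (by positivity)]; linarith
    nlinarith
  obtain ⟨Λ₀, hΛ₀, htail⟩ := sourceTail_small hh (η := ε / 4 * (2 * Real.pi ^ 2 * μ)) (by positivity)
  -- choose `j` with `ν_j < μ / Λ₀`
  obtain ⟨j, hj⟩ := ((tendsto_order.1 hν0).2 (μ / Λ₀) (by positivity)).exists
  set ν := νs j with hνdef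
  have hνpos : 0 < ν := hν j
  set Λ : ℝ := μ / ν with hΛdef
  have hΛpos : 0 < Λ := by rw [hΛdef]; positivity
  have hΛ0 : Λ₀ ≤ Λ := by
    rw [hΛdef, le_div_iff₀ hνpos]
    have := hj
    rw [lt_div_iff₀ hΛ₀] at this
    linarith
  have hνΛ : ν * Λ = μ := by rw [hΛdef]; field_simp
  obtain ⟨hXs, hXle⟩ := tsum_sq_coeff_le (hν j) hh hmean (hθ₀ j) (hweak j) (hV j)
  have hceil := d_dissipation_limsup_le (hν j) hh hmean (hθ₀ j) (hweak j) (summable_freqNormSq_mul_sq (hν j) (cs j) hh hmean)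
  have hsplit := dissipationSum_le_split (hν j) (cs j) hh hmean hΛpos hXs
  have htl := htail Λ hΛ0
  have htl0 := sourceTail_nonneg h Λ
  -- the arithmetic
  have step : 8 * Real.pi ^ 2 * ν * (Λ * (8 * E) + sourceTail h Λ / ((4 * Real.pi ^ 2 * ν) ^ 2 * Λ)) =
      64 * Real.pi ^ 2 * μ * E + sourceTail h Λ / (2 * Real.pi ^ 2 * μ) := by
    rw [← hνΛ]; field_simp; ring
  have hbound : longTimeAvgSup (fun t => νs j * (eScalarGradNormSq (θs j t)).toReal) ≤ ε / 2 := by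
    calc longTimeAvgSup (fun t => νs j * (eScalarGradNormSq (θs j t)).toReal)
        ≤ 8 * Real.pi ^ 2 * ν * ∑' k, freqNormSq k * ‖mFourierCoeff (fun x => (driftState ν (cs j) h x : ℂ)) k‖ ^ 2 := hceil
      _ ≤ 8 * Real.pi ^ 2 * ν * (Λ * (8 * E) + sourceTail h Λ / ((4 * Real.pi ^ 2 * ν) ^ 2 * Λ)) := by
          refine mul_le_mul_of_nonneg_left (hsplit.trans ?_) (by positivity)
          gcongr
      _ = 64 * Real.pi ^ 2 * μ * E + sourceTail h Λ / (2 * Real.pi ^ 2 * μ) := step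
      _ ≤ ε / 4 + (ε / 4 * (2 * Real.pi ^ 2 * μ)) / (2 * Real.pi ^ 2 * μ) := by
          gcongr
      _ = ε / 2 := by field_simp; ring
  linarith [hfl j]

end DriftAssembly


/-- **REFUTED STRENGTHENING: no witness of the crux has a constant (Galilean) flow `v_j ≡ c_j`.**
[folklore] -/
theorem not_cruxConstantDrift :
    ¬ ∃ (g : 𝕋² → E²) (h : 𝕋² → ℝ), IsAdmissible g h ∧
      ∃ (ν : ℕ → ℝ) (cs : ℕ → E²) (θ₀ : ℕ → 𝕋² → ℝ) (θ : ℕ → ℝ → 𝕋² → ℝ), (∀ j, 0 < ν j) ∧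
        Tendsto ν atTop (nhds 0) ∧ (∀ j, MemLp (θ₀ j) 2 volume) ∧
        (∀ j, IsWeakScalarTransportForced (ν j) (fun (_ : ℝ) (_ : 𝕋²) => cs j) (fun _ => h) (θ₀ j) (θ j)) ∧
        VarianceBounded θ ∧ Anomalous ν θ := by
  rintro ⟨g, h, hadm, ν, cs, θ₀, θ, hν, hν0, hθ₀, hweak, ⟨E, hE⟩, hA⟩
  exact constantDrift_not_anomalous hadm.smooth_h hadm.zeroMean_h hν hν0 hθ₀ hweak hE hA

/-- The same through the clause bundle of §1: a candidate family with constant drifts and bounded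
variance is never anomalous. [folklore] -/
theorem not_anomalous_of_isCandidate_constantDrift {g : 𝕋² → E²} {h : 𝕋² → ℝ} (hadm : IsAdmissible g h)
    {ν : ℕ → ℝ} {v₀ : ℕ → 𝕋² → E²} {cs : ℕ → E²} {θ₀ : ℕ → 𝕋² → ℝ} {θ : ℕ → ℝ → 𝕋² → ℝ}
    (hc : IsCandidate g h ν v₀ (fun j _ _ => cs j) θ₀ θ) (hV : VarianceBounded θ) : ¬ Anomalous ν θ := by
  obtain ⟨E, hE⟩ := hV
  exact constantDrift_not_anomalous hadm.smooth_h hadm.zeroMean_h hc.pos hc.tendsto hc.memLp hc.weak hE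

end ConstantDriftNoGo

/-! ## §5 VERDICT (cycle 1): no kill — why the crux resists, and what is dead

**Kill shape.** By `not_crux_iff` a refutation is a uniform NO-ANOMALY THEOREM for steadily sourced
scalars over steadily forced planar Leray–Hopf flows at `Pr = 1` in the stationary
(`limsup`-mean) regime.  In print this is open in both directions (Bruè–De Lellis 2023,
arXiv:2207.06301, p. 5, Questions 2.1–2.2 asked together with stationarity; nearest rigidity:
Bagnara–Boutros–De Lellis–Mayboroda 2026, arXiv:2603.11466 Thm 1.2, AUTONOMOUS weak-Sard planar
fields only; nearest positive results all use ν-DEPENDENT forces/sources: arXiv:2409.03599 Thm 1.5,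
Cheskidov 2023 Thm 1.3 — and `cruxIndexedSource_holds` shows the same door is open here at the
level of the typed statement: an indexed source makes it true by the bare heat equation).

**What a refutation must use** (§4): the variance bound (v) QUANTITATIVELY (without it the heat
equation gives dissipation `~ 1/ν`), and the fact that `h` is ONE `ν`-independent smooth function
(its spectrum cannot follow the diffusive scale `|k| ~ ν^{-1/2}`).  It need NOT use `g ≠ 0` or any
property of the flow beyond what kills the scalar: the crux lets the flow be at rest.

**Dead sub-families** (status):
* (a) flow at rest: DEAD IN LEAN for arbitrary `L²` data and arbitrary weak solutions of the
  class (§6 `not_cruxRestFlow`; cycle 2).  Route: linearity of the forced class + steady state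
  `-(1/ν)Δ⁻¹h` reduce to the homogeneous heat equation, whose modewise identity and energy
  inequality ARE in the tree; the a.e. Volterra lemma gives exact modal decay, whence honest
  variance means floored by `|ĥ_k|²/(8ν²λ_k²)` — unbounded along `ν_j → 0` unless `h = 0`.
* (b) Galilean / constant drifts `v_j ≡ c_j`: DEAD IN LEAN (§8 `not_cruxConstantDrift`, cycle 3), for
  arbitrary `L²` data and weak solutions; the paper sketch kept for the record:  Stationary response
  `θ̂_k = ĥ_k/(νλ_k + 2πi k·c)`, so with `X_k = |θ̂_k|²`, `Σ X_k ≤ E`: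
  `D = Σ νλ_k X_k ≤ νλ_K E + Σ_{|k|>K} |ĥ_k|²/(νλ_k) ≤ 4π²aE + ‖h_{>K}‖²/(4π²a)` for `K² = a/ν`;
  `ν → 0` then `a → 0` gives `D → 0`.  Detuning (`k·c ≠ 0`) only lowers both.  (Route notes:
  "detuned laminar swept response has variance O(1) and dissipation O(ν)".)
* (b′) band-limited PARALLEL SHEAR + DRIFT (the swept laminar sector, Kolmogorov / Galerkin shear
  flows, time-dependent profiles and drifts): DEAD IN LEAN (§9 `shearDrift_not_anomalous`,
  `sweptMarchioro_not_anomalous`, cycle 4) for arbitrary `L²` data and weak solutions.  Mechanism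
  (rigorous Batchelor/critical-layer bookkeeping at the level of the modal ODEs of WEAK solutions —
  no uniqueness, no `L²H¹` assumed; the argument PRODUCES `∫₀ᵀ‖∇θ‖² < ∞`): the shear couples a
  scalar mode `p` only to `p ± (n,0)` inside its sector `p 1 = const`, so the transport flux out of
  the box `|p 0| ≤ K, |p 1| ≤ K₂` is `≤ 4π·#S·M·K₂·(energy in the layer |p 0| ≈ K)` — weight `K₂`,
  not `K`; interior interactions cancel exactly (involution `(p,k,+) ↦ (p-k,k,-)`, transversality);
  pigeonhole over `K ∈ [K₀, K₀+N)` (each mode lies in `2R` layers) and over the outer truncation;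
  then `2ν∫⁻‖∇θ‖² ≤ ‖θ₀‖² + 8π²ν(K₁²+K₂²)∫‖θ‖² + 8πR·#S·M·K₂∫‖θ‖²/N + 2η_out(K₀,K₂)∫‖θ‖`
  (`η_out` = ℓ²-tail of `ĥ` off the box → 0).  Physics check: steady shear + steady source has
  O(1) dissipation in critical layers but variance `~ ν^{-1/3}` — excluded by (v); the theorem's
  rate is the matching `ν^{1/3}`-type.  So a witness of the crux needs stirring whose Fourier
  support is NOT confined to a bounded set of parallel modes: genuinely two-dimensional (cellular
  or turbulent) coupling with `j`-unbounded spectral reach.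
* (b″) ANY UNIFORMLY BAND-LIMITED stirring (Fourier support of `v_j` in a fixed box, amplitudes
  bounded uniformly in `j`; cellular and swept-cellular flows, fixed Galerkin truncations): DEAD IN
  LEAN (§10 `bandLimited_not_anomalous`, cycle 5), any `L²` data, any weak solutions.  The involution /
  band identity of §9 are geometry-free; the flux through `|p|_∞ = K` now weighs `K + R` (both indices
  shift: exponential stretching), the `2R`-fold overlapping square layers and a HARMONIC pigeonhole
  over `K ∈ [K₀, K₀+n)` give the factor `1/∑(K+R)⁻¹ ~ 1/log(K₁/K₀)` with `K₁ ~ ν^{-1/2}` — Batchelor's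
  logarithm, rigorous for weak solutions; the outer truncation (weight `K'`) is removed against the
  time-integrated spectral TAIL of the variance (dominated convergence + Parseval), not the full variance.
* (c) single-shell `g`: dead (item evidence SINGLE_SHELL_2HALFD.md: Tran–Shepherd identity ⇒
  ν-uniform `H¹` flow at bounded energy ⇒ DiPerna–Lions renormalisation of the limit scalar ⇒
  `ν_j⟨‖∇θ_j‖²⟩ = ⟨(h,θ_j)⟩ → 0`).
* (d) steady / autonomous-limit planar states: no anomaly (arXiv:2603.11466 Thm 1.2, weak Sard).
* (e) uniformly Lipschitz drifts `sup_j ‖∇v_j‖_{L^∞_{t,x}} = L < ∞`: dead on paper by the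
  Batchelor logarithm — stationary flux through every dyadic shell between the source scale and
  the diffusive scale `k_d ~ (L/ν)^{1/2}` equals `χ_j` up to `O(νk²E)`, and a Lipschitz commutator
  bound gives flux `≤ C·L·(variance in the shell)`, whence `E ≥ Σ_shells χ_j/(CL) ≈ χ_j
  log(1/ν_j)/(2CL)` and `χ_j ≲ 2CLE/log(1/ν_j) → 0` (sourced analogue of the catalogued
  `DrivasElgindiIyerJeong2022_thm4`; rigorous write-up not in tree).  So witnesses need
  `‖∇v_j‖_∞ ≳ log(1/ν_j)` — allowed by the budgets `ν⟨‖∇v‖²⟩ = ⟨(g,v)⟩ ≤ ‖g‖√E`,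
  `ν⟨‖Δv‖²⟩ ≤ ‖∇g‖_∞√E`, which is why no budget argument closes the kill.

**Why no cheap Lean kill of the genuine statement or of strengthenings beyond (a):** the weak
class `IsWeakScalarTransportForcedOn` records no energy inequality and no `L²_tH¹_x`; every
negative statement about GENUINE witnesses (flux identity `ν⟨‖∇θ‖²⟩ = ⟨(h,θ)⟩`, power bound
`ε ≤ ‖h‖√E`, Bernstein for band-limited scalars, drift no-go) needs uniqueness + energy equality
of the sourced equation over Leray–Hopf drifts (true on paper: DiPerna–Lions with
`θ ∈ L^∞L²`, `v ∈ L²H¹`, `1/2 + 1/2 = 1`), absent from the tree.  Junk cannot be used against the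
item either: (vi) is junk-proof (§2) and (v)-junk needs divergent variance means, impossible for
energy solutions at fixed `ν_j > 0` (mean conservation + Poincaré + `κ`-damping).

**Line `budgeted-mixer-template` (PICKED; lead skeleton `Lines/budgeted_mixer_template.lean`, reshape r1).**
Only open stub: S1' `stub_profileMixerRealizable` (XL ∃ = residual crux: steady-forced classical NS
family whose releases of ONE profile `h` decay under a `j`-uniform integrable antitone majorant, plus a
cold-start floor at one lag).  JUNK AUDIT of S1' (this seat, cycle 6): no door — `h = 0` is excluded by
(Floor) (`c₀ ≤ ∫ 0·θ' = 0`); (Decay)/(Floor) are not vacuous because classical scalar solutions over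
classical NS drifts exist (tree well-posedness) and the transfer constructs them; `∫₀ᵗρm ≤ R` forces
`ρm → 0`, so (Decay) is genuine uniform-in-`ν` mixing (fails for `g = 0`: heat decay `e^{-4π²ν_jt}` is
not `j`-uniform); ρm(0) ≥ 1 is consistent.  NECESSARY CONDITIONS any S1'-witness inherits through the
transfer `ScalarAnomalySteadySourceFormal_of` (all kernel-checked here): its velocities are not
uniformly band-limited (§10), violate `R_j#S_jM_j = o(log 1/ν_j)` for every band-limited approximation
scheme with support `≤ ν_j^{-γ}`, `γ<1/2` (§10.5), are unbounded in every uniform Fourier-decay class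
`(1+|q|_∞)^{-σ}`, `σ>4` (§12.8) and in the two-moment Wiener class (§12); and the released/sourced
scalars carry time-mean spectral mass at `|k| ≳ ν_j^{-1/2}` (§11) — i.e. (Decay) with an integrable
majorant is mixing to the Batchelor scale in `O(1)` time, uniformly in `ν`.  Nothing in S1' is cheaply
refutable: it is the open dynamical statement.  `stuck_stubs = []`.

**Targets (old note).** None at cycles 1–3 (no line picked then).  DONE: cycle 2 (1) the rest-flow
no-go `not_cruxRestFlow` (§6); cycle 3 (2) constant drifts (§8); cycle 4 (2′) shear–drift / swept
laminar sector (§9); cycle 5 (2″) ANY uniformly band-limited stirring (§10).  DONE (α): quantitative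
growth version `growingBand_not_anomalous` (§10.5: `R_j #S_j M_j = o(log 1/ν_j)` & support `≤ ν^{-γ}`,
`γ<1/2` ⇒ no anomaly).  DONE (β, in Wiener form §12). NEXT: (β') uniformly LIPSCHITZ (not band-limited) stirring — needs a
Littlewood–Paley flux bound (commutator) instead of the finite shift structure; (γ) the stubs of a
picked line when one exists.  OLD LIST: (2) constant drifts `v_j ≡ c_j` (Galilean states; the same
§6 machinery after conjugating by the translation `x ↦ x - c t`, or directly: modes
`θ̂_k' = -(νλ_k + 2πik·c)θ̂_k + ĥ_k`); (3) scalar Bernstein ⇒ band-limited periodic witnesses dead;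
(4) grade the cards' typed first lemmas (`ShellSignRuleAlgebra`, `ShortTimeCorrelationFloor`)
against §2's junk calculus; (5) the forced-class toolkit of §6 (`forced_sub`, product-form weak
identity) is half of the provers' missing glue `SourcedScalarWellPosed2D` — offer it.
-/



/-! ## §9 / §11 (LANDED) — restated from the tree modules `Negative.ShearNoGo`, `Negative.ShearSwept`,
`Negative.ScalarReach` (imported above; the Cell*/Wien* heads follow when those modules land). -/
section LandedHeads

open Summit.AnomalousDissipation.AnomalousDissipation.Theorems.ScalarAnomalySteadySourceFormal.Negative

/-- §9 (landed p90342): no witness of the crux is stirred by uniformly bounded, band-limited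
shear–drift flows — `Negative.ShearNoGo.not_cruxShearDrift`. -/
theorem crux_shearDrift_strengthening_false (S : Finset (Fin 2 → ℤ)) (R : ℕ) (M : ℝ)
    (hS : ∀ k ∈ S, k 1 = 0 ∧ |k 0| ≤ R) (hM0 : 0 ≤ M) :
    ¬ ∃ (g : UnitAddTorus (Fin 2) → EuclideanSpace ℝ (Fin 2)) (h : UnitAddTorus (Fin 2) → ℝ), IsAdmissible g h ∧
      ∃ (ν : ℕ → ℝ) (cs : ℕ → ℝ → (Fin 2 → ℤ) → EuclideanSpace ℂ (Fin 2))
        (v : ℕ → ℝ → UnitAddTorus (Fin 2) → EuclideanSpace ℝ (Fin 2))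
        (θ₀ : ℕ → UnitAddTorus (Fin 2) → ℝ) (θ : ℕ → ℝ → UnitAddTorus (Fin 2) → ℝ),
        (∀ j, 0 < ν j) ∧ Tendsto ν atTop (nhds 0) ∧
        (∀ j k, Continuous fun s => cs j s k) ∧ (∀ j s k, ‖cs j s k‖ ≤ M) ∧
        (∀ j s, ∀ k ∈ S, zdot k (cs j s k) = 0) ∧ (∀ j s, v j s = realTrigPoly S (cs j s)) ∧
        (∀ j, MemLp (θ₀ j) 2 volume) ∧
        (∀ j, IsWeakScalarTransportForced (ν j) (v j) (fun _ => h) (θ₀ j) (θ j)) ∧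
        VarianceBounded θ ∧ Anomalous ν θ :=
  not_cruxShearDrift S R M hS hM0

/-- §9.9 (landed p92130): the Galilean-swept Marchioro family (the planner's repaired crux #3′ states)
carries no anomaly — `Negative.ShearSwept.not_anomalous_of_isCandidate_swept`. -/
theorem swept_candidates_not_anomalous (α : ℝ) {m : EuclideanSpace ℝ (Fin 2)} (hm : m 0 ≠ 0)
    {g : UnitAddTorus (Fin 2) → EuclideanSpace ℝ (Fin 2)} {h : UnitAddTorus (Fin 2) → ℝ} (hadm : IsAdmissible g h)
    {ν : ℕ → ℝ} {v₀ : ℕ → UnitAddTorus (Fin 2) → EuclideanSpace ℝ (Fin 2)}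
    {θ₀ : ℕ → UnitAddTorus (Fin 2) → ℝ} {θ : ℕ → ℝ → UnitAddTorus (Fin 2) → ℝ}
    (hcand : IsCandidate g h ν v₀ (fun j => Literature.Barriers.AnomalousDissipation.marchioroSweptState α (ν j) m) θ₀ θ)
    (hV : VarianceBounded θ) : ¬ Anomalous ν θ :=
  not_anomalous_of_isCandidate_swept α hm hadm hcand hV

/-- §11 (landed p91132): a candidate family whose SCALARS stay band-limited below the diffusive
scale (`ν_jΛ_j² → 0`) is not anomalous — `Negative.ScalarReach.not_anomalous_of_isCandidate_scalarBandLimited`. -/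
theorem scalarBandLimited_candidates_not_anomalous {g : UnitAddTorus (Fin 2) → EuclideanSpace ℝ (Fin 2)}
    {h : UnitAddTorus (Fin 2) → ℝ} (hadm : IsAdmissible g h) {ν : ℕ → ℝ}
    {v₀ : ℕ → UnitAddTorus (Fin 2) → EuclideanSpace ℝ (Fin 2)} {v : ℕ → ℝ → UnitAddTorus (Fin 2) → EuclideanSpace ℝ (Fin 2)}
    {θ₀ : ℕ → UnitAddTorus (Fin 2) → ℝ} {θ : ℕ → ℝ → UnitAddTorus (Fin 2) → ℝ}
    (hcand : IsCandidate g h ν v₀ v θ₀ θ) {Λs : ℕ → ℝ}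
    (hband : ∀ j t, ∀ k : Fin 2 → ℤ, Λs j ^ 2 < FunctionSpaces.Torus.freqNormSq k → mFourierCoeff (fun x => (θ j t x : ℂ)) k = 0)
    (hνΛ : Tendsto (fun j => ν j * Λs j ^ 2) atTop (nhds 0)) (hV : VarianceBounded θ) : ¬ Anomalous ν θ :=
  not_anomalous_of_isCandidate_scalarBandLimited hadm hcand hband hνΛ hV

/-- §10 (landed p92179): no witness of the crux is stirred by ANY uniformly band-limited family of flows
(finite Fourier support in a fixed box, amplitudes bounded uniformly in `j`) —
`Negative.CellNoGo.not_anomalous_of_isCandidate_bandLimited`. -/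
theorem bandLimited_candidates_not_anomalous {S : Finset (Fin 2 → ℤ)} {R : ℕ} {M : ℝ}
    (hS : ∀ k ∈ S, |k 0| ≤ R ∧ |k 1| ≤ R) (hM0 : 0 ≤ M)
    {g : UnitAddTorus (Fin 2) → EuclideanSpace ℝ (Fin 2)} {h : UnitAddTorus (Fin 2) → ℝ} (hadm : IsAdmissible g h)
    {ν : ℕ → ℝ} {v₀ : ℕ → UnitAddTorus (Fin 2) → EuclideanSpace ℝ (Fin 2)}
    {v : ℕ → ℝ → UnitAddTorus (Fin 2) → EuclideanSpace ℝ (Fin 2)}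
    {cs : ℕ → ℝ → (Fin 2 → ℤ) → EuclideanSpace ℂ (Fin 2)} (hc : ∀ j k, Continuous fun s => cs j s k)
    (hM : ∀ j s k, ‖cs j s k‖ ≤ M) (htrans : ∀ j s, ∀ k ∈ S, zdot k (cs j s k) = 0)
    (hu : ∀ j s, v j s = realTrigPoly S (cs j s))
    {θ₀ : ℕ → UnitAddTorus (Fin 2) → ℝ} {θ : ℕ → ℝ → UnitAddTorus (Fin 2) → ℝ}
    (hcand : IsCandidate g h ν v₀ v θ₀ θ) (hV : VarianceBounded θ) : ¬ Anomalous ν θ :=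
  not_anomalous_of_isCandidate_bandLimited hS hM0 hadm hc hM htrans hu hcand hV

/-- §10.5 (landed p93031): QUANTITATIVE BATCHELOR NO-GO — growing bands with `R_j #S_j M_j = o(log 1/ν_j)`
and support `≤ ν_j^{-γ}`, `γ < 1/2`, carry no anomaly — `Negative.CellQuant.growingBand_not_anomalous`. -/
theorem growingBand_families_not_anomalous {h : UnitAddTorus (Fin 2) → ℝ} (hh : IsSmooth h) (hmean : HasZeroMean h)
    {S : ℕ → Finset (Fin 2 → ℤ)} {R : ℕ → ℕ} {M : ℕ → ℝ}
    (hS : ∀ j, ∀ k ∈ S j, |k 0| ≤ R j ∧ |k 1| ≤ R j) (hM0 : ∀ j, 0 ≤ M j)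
    {νs : ℕ → ℝ} (hν : ∀ j, 0 < νs j) (hν0 : Tendsto νs atTop (nhds 0))
    (hgrowth : ∀ δ : ℝ, 0 < δ → ∀ᶠ j in atTop, (R j : ℝ) * (S j).card * M j ≤ δ * Real.log (1 / νs j))
    {γ : ℝ} (hγ : γ < 1 / 2) (hreach : ∀ᶠ j in atTop, Real.log ((R j : ℝ) + 1) ≤ γ * Real.log (1 / νs j))
    {cs : ℕ → ℝ → (Fin 2 → ℤ) → EuclideanSpace ℂ (Fin 2)} (hc : ∀ j k, Continuous fun s => cs j s k)
    (hM : ∀ j s k, ‖cs j s k‖ ≤ M j) (htrans : ∀ j s, ∀ k ∈ S j, zdot k (cs j s k) = 0)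
    {us : ℕ → ℝ → UnitAddTorus (Fin 2) → EuclideanSpace ℝ (Fin 2)} (hu : ∀ j s, us j s = realTrigPoly (S j) (cs j s))
    {θ₀s : ℕ → UnitAddTorus (Fin 2) → ℝ} (hθ₀ : ∀ j, MemLp (θ₀s j) 2 volume)
    {θs : ℕ → ℝ → UnitAddTorus (Fin 2) → ℝ}
    (hweak : ∀ j, IsWeakScalarTransportForced (νs j) (us j) (fun _ => h) (θ₀s j) (θs j))
    {E : ℝ} (hV : ∀ j, longTimeAvgSup (fun t => scalarL2Sq (θs j t)) ≤ E) :
    ¬ ∃ ε : ℝ, 0 < ε ∧ ∀ j, ε ≤ longTimeAvgSup (fun t => νs j * (eScalarGradNormSq (θs j t)).toReal) :=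
  growingBand_not_anomalous hh hmean hS hM0 hν hν0 hgrowth hγ hreach hc hM htrans hu hθ₀ hweak hV

/-- §12 (landed p93688): uniformly Wiener-class stirring (infinite Fourier support, one two-moment
majorant uniformly in `j`) carries no anomaly — `Negative.WienNoGo.not_anomalous_of_isCandidate_wiener`. -/
theorem wiener_candidates_not_anomalous {a : (Fin 2 → ℤ) → ℝ}
    {g : UnitAddTorus (Fin 2) → EuclideanSpace ℝ (Fin 2)} {h : UnitAddTorus (Fin 2) → ℝ} (hadm : IsAdmissible g h)
    {ν : ℕ → ℝ} {v₀ : ℕ → UnitAddTorus (Fin 2) → EuclideanSpace ℝ (Fin 2)}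
    {v : ℕ → ℝ → UnitAddTorus (Fin 2) → EuclideanSpace ℝ (Fin 2)}
    {θ₀ : ℕ → UnitAddTorus (Fin 2) → ℝ} {θ : ℕ → ℝ → UnitAddTorus (Fin 2) → ℝ}
    (hcand : IsCandidate g h ν v₀ v θ₀ θ)
    (hsa : Summable a) (hsa1 : Summable fun q => (qrad q : ℝ) * a q) (hsa2 : Summable fun q => (qrad q : ℝ) ^ 2 * a q)
    {Cs : ℕ → ℝ → (Fin 2 → ℤ) → EuclideanSpace ℂ (Fin 2)} (hCa : ∀ j s q, ‖Cs j s q‖ ≤ a q)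
    (hsymm : ∀ j s q, Cs j s (-q) = EuclideanSpace.conjVec (Cs j s q)) (hcont : ∀ j q, Continuous fun s => Cs j s q)
    (htrans : ∀ j s q, zdot q (Cs j s q) = 0) (hv : ∀ j s, v j s = wienField (Cs j s))
    (hV : VarianceBounded θ) : ¬ Anomalous ν θ :=
  not_anomalous_of_isCandidate_wiener hadm hcand hsa hsa1 hsa2 hCa hsymm hcont htrans hv hV

end LandedHeads

end Summit.AnomalousDissipation.AnomalousDissipation.Cruxes.ScalarAnomalySteadySourceFormal.Disproof
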